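/-
Copyright (c) 2026 the pub-hodgecm-mathlib formalisation cell (harness21).  Prover seat hodgecm-mathlib-K2E3-p12 (g9) (W3c, generator of the L4 architect K2E3-p25 (g3)), HCML Track B «K2-LIT» ∕ h413
(`stmt-HodgeConjecture-24833`).  NR-1′ «LeThree SWEEP» (director s1979∕s1980): the hHC∕hHCB-binding theorems of ★ `K2E3EllipticInnerNonzeroIsPair` RE-READ under the NARROWED letters
hHC₃ `characterLocallyIntegrableLeThree` ∕ hHCB₃ `normalizedCharacter_locallyBoundedLeThree` (`2 ≤ N ≤ 3`, `v` non-split) — SAME NAMES, namespace `…K2E3EllipticInnerNonzeroIsPairLeThree`.  2026-09-04.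
-/
import Summits.HodgeConjecture.HodgeConjecture.Theorems.F0P3cStCharTSDatumJunction17   -- ★ JUNCTION v17 (LH6-p01): brings every ★ dock used below — (X3′) «(b)-REST NOT-WILD» `F0P3cStCharTSP1261bRestNotWild`, «HC-SC» `F0P3cStCharTSScPseudoCoeff` (N0), `F0P3cStCharTSScFin`, PS-VANISH, LDS-FIELDS, RED-JH, WIF-AT-THE-DATUM, JAC-ELL C8, CARTAN-REPS∕FIELDS∕NULL, L2D-ELL, L2D-OF-HCB, DG-FIELD, the named fact `normalizedCharacter_locallyBounded`
import Summits.HodgeConjecture.HodgeConjecture.Theorems.F0P3cStCharTSRung0TwentyTwo     -- ★ RUNG 0 v22 (its import cone): ★ KEYS3-ANALYTIC `hKeysRed3_holds`, ★ LDS-RED-TWO `ldsRedTwo_of_keysRedThree`, ★ LDS-TWO-OF-TWO `ldsTwo_of_ldsReducibleTwo`, ★ `isQuadraticCharExtension_semilocalComponent_of_baseChange_eq`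
import HarnessLib
import Summits.HodgeConjecture.HodgeConjecture.Theorems.K2E3EllipticInnerNonzeroIsPair   -- ★ the original: every non-letter lemma REUSED by qualified name
import Summits.HodgeConjecture.HodgeConjecture.Theorems.K2E3CharLettersLeThreeDefs   -- NR-1′ root: hHC₃ ∕ hHCB₃
import Summits.HodgeConjecture.HodgeConjecture.Theorems.K2E3L2dOfHcbLeThree   -- NR-1′ twin of ★ L2dOfHcb (the `l2dEll_of_hcBounded` site, +hns)

/-!
# NR-1′ twin — ★ `K2E3EllipticInnerNonzeroIsPair` under the narrowed Harish-Chandra letters (`2 ≤ N ≤ 3`, `v` non-split)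

Cell `pub/hodgecm-mathlib`, crux H413 = `stmt-HodgeConjecture-24833`, line L4 `stub_StCharTS`; director rulings NR-1′ (s1979) ∕ «GO — LeThree SWEEP» (s1980); architect memo
`K2/K2E3-p25/g3/NR1-narrowing-cone.K2E3-p25-g3.md`.  THEOREMS ONLY; count-neutral helper (`--supports stmt-HodgeConjecture-24833 --as helper`).  Exactly the theorems of the
original ★ file whose statements bind `Ch1.characterLocallyIntegrable` ∕ `normalizedCharacter_locallyBounded`, copied with the binder TYPE replaced by hHC₃ ∕ hHCB₃
(★ `K2E3CharLettersLeThreeDefs`), the rank∕non-split arguments supplied at each application (`2 ≤ N`, `N ≤ 3` by `norm_num`; the organ's `∀ w ∣ v, conj • w = w`), an added `hns`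
binder where the original head was place-agnostic, and calls into other cone files re-pointed to their twins; every other lemma of the original is used BY QUALIFIED NAME.
No new mathematics.  The original ★ declarations are untouched.

HONEST LABEL: HC_CM is proved only modulo the 7 printed citations (2 remaining named inputs: hLiu418 = `stmt-HodgeConjecture-24832`, h413 = `stmt-HodgeConjecture-24833`) until rung 0
closes; count-neutral; CONDITIONAL on the narrowed letters (stated, not assumed).

## References
* [Rogawski1990] J. D. Rogawski, *Automorphic Representations of Unitary Groups in Three Variables* (1990), §1.6 p. 5; §4.9 p. 54; §12.5–12.7.
* [HarishChandra1999AdmissibleDistributions] Harish-Chandra, *Admissible Invariant Distributions on Reductive p-adic Groups*, ULS 16 (1999), Thm. 16.3.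
-/

set_option autoImplicit false
-- the mandated namespace has the single-problem summit's repeated segment (`HodgeConjecture.HodgeConjecture`)
set_option linter.dupNamespace false

noncomputable section

open NumberField IsDedekindDomain MeasureTheory Filter Topology
open scoped Matrix MatrixGroups NNReal ENNReal
open Literature.MeasureTheory.Group
open Literature.NumberTheory.Rogawski1990 Literature.NumberTheory.Automorphic Literature.NumberTheory.Automorphic.UnitaryGroup
open Literature.NumberTheory.Automorphic.UnitaryGroup.CotangentForms Literature.NumberTheory.GaloisRepresentations
open Literature.NumberTheory.Automorphic.Arthur2013.Leaves.TECR
open Summit.HodgeConjecture.HodgeConjecture.Cruxes.H413.F0P3cStCharTSTorusDefs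

open Summit.HodgeConjecture.HodgeConjecture.Cruxes.H413.K2E3CharLettersLeThreeDefs

namespace Summit.HodgeConjecture.HodgeConjecture.Cruxes.H413.K2E3EllipticInnerNonzeroIsPairLeThree

open Summit.HodgeConjecture.HodgeConjecture.Cruxes.H413

set_option maxHeartbeats 16000000 in
set_option synthInstance.maxHeartbeats 400000 in
-- budget: two copies of the organ's 66-binder ∕ 54-pin frame (class of ★ JUNCTION v17 ∕ ★ RUNG 0 v22, which run at 8M–16M) + the three `IsConstituentOf (cmPrincipalSeries …)` shapes of ★ RED-JH
open Pointwise in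
open scoped Classical in
/-- **PROP. 12.6.1 (b) AT THE PINNED DATUM, UNGATED (= socket `sig_K2E3EllipticInnerNonzeroIsPair`, SIGS-TABLE-K2E3 row #16), FROM ITS THREE NAMED INPUTS.**
Under the organ's prefix, Cartan binders and `EllipticData` datum `𝔇` with its 54 pins (the socket's frame TOKEN FOR TOKEN): for all classes `π ≠ π′` of `U(Φ₃)(L⁺_v)`
that are elliptic (`χ_π ≢ 0` on `G^e`) with `⟨χ_π, χ_π′⟩_e ≠ 0`, the pair `{π, π′}` is an l.d.s. packet, `{St_G(ψ), ψ∘det_G}` or `{π²(ξ), πⁿ(ξ)}` (★ `IsEllipticPair`) —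
GIVEN (1) `hHCB` = stub 2 (local boundedness of the normalised character), (2) `hKeysRed` = stub 4 (Keys' list, ⇒), (3) `hWild` = stub 5's consequent 3 (the statement for
non-supercuspidal pairs at a WILD place).  Supercuspidal members are orthogonal to everything else by ★ (N0) (compact induction + Schur, in house); non-supercuspidal pairs
at a not-wild place are ★ (X3′) (Jacquet-line block separation + the EP cross-trace-zero socket + Rogawski's §12.2 list from `hKeysRed`); the wild non-supercuspidal
pairs are exactly `hWild`.  Proof = ★ JUNCTION v17 :239–:356 re-run at this frame (see the module docstring).
[cite: Rogawski1990, §12.6 Prop. 12.6.1 (b) p. 188, proof p. 189; §12.2 pp. 173–174] [cite: Kazhdan1986CuspidalGeometry, Thm. F] [cite: Keys1984, §7 Thm.]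
[cite: HarishChandra1999AdmissibleDistributions, Part III Thm. 16.3] -/
theorem ellipticInnerNonzeroIsPair_of_inputs
    -- INPUT 1 = tier-0 stub 2 `stub_charLocBdd` BY NAME (★ named fact, [HarishChandra1999AdmissibleDistributions III Thm. 16.3]): local boundedness of `|D|^{1∕2} Θ_π` (U12 rows 12∕14)
    (hHCB : normalizedCharacter_locallyBoundedLeThree)
    -- INPUT 2 = tier-0 stub 4 `stub_keysReducibleList` BY NAME (its type VERBATIM, `Pl` unfolded): Keys' reducibility list, direction (⇒) (U4 rows 4–6) [cite: Keys1984, §7 Thm.] [cite: Rogawski1990, §12.2 p. 173]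
    (hKeysRed :
      ∀ (L : Type) [Field L] [NumberField L] [IsCMField L] (v : HeightOneSpectrum (𝓞 ↥(maximalRealSubfield L))),
      (∀ w : PlacesOver L v, IsCMField.complexConj L • w.1 = w.1) →
      (∀ (χ₁ : (UnitaryGroup.LocalRing L v)ˣ →* ℂˣ) (χ₂ : ↥(normOneUnits (conjLocal L (IsCMField.complexConj L) v)) →* ℂˣ), Continuous (fun x => ((χ₁ x : ℂˣ) : ℂ)) → Continuous (fun x => ((χ₂ x : ℂˣ) : ℂ)) → (∃ N : Subrepresentation (UnitaryGroup.cmPrincipalSeries L 3 v (UnitaryGroup.cmTorusCharPair L v χ₁ χ₂)), N ≠ ⊥ ∧ N ≠ ⊤) → (χ₁ = halfModulusChar (UnitaryGroup.LocalRing L v) * halfModulusChar (UnitaryGroup.LocalRing L v) ∨ χ₁ = (halfModulusChar (UnitaryGroup.LocalRing L v) * halfModulusChar (UnitaryGroup.LocalRing L v))⁻¹) ∨ (∃ η : (UnitaryGroup.LocalRing L v)ˣ →* ℂˣ, IsQuadraticCharExtension (conjLocal L (IsCMField.complexConj L) v) η ∧ Continuous (fun x => ((η x : ℂˣ) : ℂ))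 ∧ (χ₁ = η * halfModulusChar (UnitaryGroup.LocalRing L v) ∨ χ₁ = η * (halfModulusChar (UnitaryGroup.LocalRing L v))⁻¹)) ∨ (χ₁ ≠ 1 ∧ ∀ a : (UnitaryGroup.LocalRing L v)ˣ, (conjLocal L (IsCMField.complexConj L) v) (a : UnitaryGroup.LocalRing L v) = a → χ₁ a = 1)))
    -- INPUT 3 = THE WILD KERNEL: tier-0 stub 5 `stub_kazhdanOrthogonalityWild`, consequent 3 VERBATIM (Prop. 12.6.1 (b) for NON-SUPERCUSPIDAL pairs at a WILD place) under this sig's own frame (66 binders VERBATIM, `Pl`∕`HLoc` unfolded) [cite: Rogawski1990, Prop. 12.6.1 (b) p. 188, proof p. 189 «[K], Theorem F»] [cite: Kazhdan1986CuspidalGeometry, Thm. F]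
    (hWild :
      ∀ (L : Type) [Field L] [NumberField L] [IsCMField L] (μ : HeckeCharacter L) (ξ : OneDimAutRepH L) (v : HeightOneSpectrum (𝓞 ↥(maximalRealSubfield L))),
      (∀ w : PlacesOver L v, IsCMField.complexConj L • w.1 = w.1) → μ.IsUnitary →
      (∀ x : Literature.NumberTheory.GaloisRepresentations.ideleGroup ↥(maximalRealSubfield L),
      μ (AdeleRing.ideleBaseChange (↥(maximalRealSubfield L)) L x) = quadraticHeckeCharCM L x) →
      ∀ [MeasurableSpace (((UnitaryGroup.cmDatum L 2 (Matrix.of fun i j : Fin 2 => if i.val + j.val + 1 = 2 then (1 : L) else 0)).Local v × (UnitaryGroup.cmDatum L 1 (Matrix.of fun i j : Fin 1 => if i.val + j.val + 1 = 1 then (1 : L) else 0)).Local v))] [BorelSpace (((UnitaryGroup.cmDatum L 2 (Matrix.of fun i j : Fin 2 => if i.val + j.val + 1 = 2 then (1 : L) else 0)).Local v × (UnitaryGroup.cmDatum L 1 (Matrix.of fun i j : Fin 1 => if i.val + j.val + 1 = 1 then (1 : L) else 0)).Local v))] [MeasurableSpace (Gqs L v)] [BorelSpace (Gqs L v)]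
      (νHv : Measure (((UnitaryGroup.cmDatum L 2 (Matrix.of fun i j : Fin 2 => if i.val + j.val + 1 = 2 then (1 : L) else 0)).Local v × (UnitaryGroup.cmDatum L 1 (Matrix.of fun i j : Fin 1 => if i.val + j.val + 1 = 1 then (1 : L) else 0)).Local v))) (νQv : Measure (Gqs L v))
      [νHv.IsHaarMeasure] [νHv.IsMulRightInvariant] [νQv.IsHaarMeasure] [νQv.IsMulRightInvariant],
      letI : ∀ a : ((UnitaryGroup.cmDatum L 2 (Matrix.of fun i j : Fin 2 => if i.val + j.val + 1 = 2 then (1 : L) else 0)).Local v × (UnitaryGroup.cmDatum L 1 (Matrix.of fun i j : Fin 1 => if i.val + j.val + 1 = 1 then (1 : L) else 0)).Local v), MeasurableSpace (((UnitaryGroup.cmDatum L 2 (Matrix.of fun i j : Fin 2 => if i.val + j.val + 1 = 2 then (1 : L) else 0)).Local v × (UnitaryGroup.cmDatum L 1 (Matrix.of fun i j : Fin 1 => if i.val + j.val + 1 = 1 then (1 : L) else 0)).Local v) ⧸ Subgroup.centralizer ({a} : Set (((UnitaryGroup.cmDatum L 2 (Matrix.of fun i j : Fin 2 => if i.val + j.val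 + 1 = 2 then (1 : L) else 0)).Local v × (UnitaryGroup.cmDatum L 1 (Matrix.of fun i j : Fin 1 => if i.val + j.val + 1 = 1 then (1 : L) else 0)).Local v)))) := fun _ => borel _
      haveI : ∀ a : ((UnitaryGroup.cmDatum L 2 (Matrix.of fun i j : Fin 2 => if i.val + j.val + 1 = 2 then (1 : L) else 0)).Local v × (UnitaryGroup.cmDatum L 1 (Matrix.of fun i j : Fin 1 => if i.val + j.val + 1 = 1 then (1 : L) else 0)).Local v), BorelSpace (((UnitaryGroup.cmDatum L 2 (Matrix.of fun i j : Fin 2 => if i.val + j.val + 1 = 2 then (1 : L) else 0)).Local v × (UnitaryGroup.cmDatum L 1 (Matrix.of fun i j : Fin 1 => if i.val + j.val + 1 = 1 then (1 : L) else 0)).Local v) ⧸ Subgroup.centralizer ({a} : Set (((UnitaryGroup.cmDatum L 2 (Matrix.of fun i j : Fin 2 => if i.val + j.val + 1 = 2 then (1 : L) else 0)).Local v × (UnitaryGroup.cmDatum L 1 (Matrix.of fun i j : Fin 1 => if i.val + j.val + 1 = 1 then (1 : L) else 0)).Local v)))) := fun _ => ⟨rfl⟩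
      letI : ∀ γ : Gqs L v, MeasurableSpace (Gqs L v ⧸ Subgroup.centralizer ({γ} : Set (Gqs L v))) := fun _ => borel _
      haveI : ∀ γ : Gqs L v, BorelSpace (Gqs L v ⧸ Subgroup.centralizer ({γ} : Set (Gqs L v))) := fun _ => ⟨rfl⟩
      ∀ (mHv : OrbitalMeasureFamily (((UnitaryGroup.cmDatum L 2 (Matrix.of fun i j : Fin 2 => if i.val + j.val + 1 = 2 then (1 : L) else 0)).Local v × (UnitaryGroup.cmDatum L 1 (Matrix.of fun i j : Fin 1 => if i.val + j.val + 1 = 1 then (1 : L) else 0)).Local v))) (mQv : OrbitalMeasureFamily (Gqs L v)),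
      mHv.IsCanonical (IsLocalGRegular L v) νHv →
      mQv.IsCanonical (fun γ => IsRegularElt (γ.val : GL (Fin 3) (UnitaryGroup.LocalRing L v))) νQv →
      IsLocalDeltaTransferExists L (qsForm L) v ((finExplicitCollection L (qsForm L) μ (finExplicitDelta_conj_left_all L (qsForm L) μ) (finExplicitDelta_conj_right_all L (qsForm L) μ)) v) mHv mQv IsLocSmooth IsLocSmooth →
      ∀ (π₁ πSt : IrrClass (((UnitaryGroup.cmDatum L 2 (Matrix.of fun i j : Fin 2 => if i.val + j.val + 1 = 2 then (1 : L) else 0)).Local v × (UnitaryGroup.cmDatum L 1 (Matrix.of fun i j : Fin 1 => if i.val + j.val + 1 = 1 then (1 : L) else 0)).Local v))),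
      HLengthTwoLabels L v
      (torusCharPair (conjLocal L (IsCMField.complexConj L) v) (cmLocalForm L 2 v) (cmLocalForm_eq_over L 2 v) 0
      ((torusLocalComponent L (IsCMField.complexConj L) v ξ.η).comp
      (quotConj (conjLocal L (IsCMField.complexConj L) v) (conjLocal_conjLocal_cm L v)) *
      halfModulusChar (UnitaryGroup.LocalRing L v))
      (torusLocalComponent L (IsCMField.complexConj L) v ξ.ψ))
      ((torusLocalComponent L (IsCMField.complexConj L) v ξ.ψ).comp (localDet (IsCMField.complexConj L) v (isUnit_antidiagOne_det L 1))) π₁ πSt →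
      (∀ fH : ((UnitaryGroup.cmDatum L 2 (Matrix.of fun i j : Fin 2 => if i.val + j.val + 1 = 2 then (1 : L) else 0)).Local v × (UnitaryGroup.cmDatum L 1 (Matrix.of fun i j : Fin 1 => if i.val + j.val + 1 = 1 then (1 : L) else 0)).Local v) → ℂ, IsLocSmooth fH → π₁.smoothTrace νHv fH = charDist (ξ.xiLocalChar v) νHv fH) →
      ∀ [MeasurableSpace (Gqs L v ⧸ Subgroup.center (Gqs L v))] [BorelSpace (Gqs L v ⧸ Subgroup.center (Gqs L v))]
      (μZ : Measure (Gqs L v ⧸ Subgroup.center (Gqs L v))) [μZ.IsHaarMeasure],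
      ∀ (Sell : Finset (Subgroup (Gqs L v))) (μTf : (T' : Subgroup (Gqs L v)) → Measure ↥T') (SH : Finset (Subgroup ((UnitaryGroup.cmDatum L 2 (Matrix.of fun i j : Fin 2 => if i.val + j.val + 1 = 2 then (1 : L) else 0)).Local v × (UnitaryGroup.cmDatum L 1 (Matrix.of fun i j : Fin 1 => if i.val + j.val + 1 = 1 then (1 : L) else 0)).Local v))) (μTHf : (T' : Subgroup ((UnitaryGroup.cmDatum L 2 (Matrix.of fun i j : Fin 2 => if i.val + j.val + 1 = 2 then (1 : L) else 0)).Local v × (UnitaryGroup.cmDatum L 1 (Matrix.of fun i j : Fin 1 => if i.val + j.val + 1 = 1 then (1 : L) else 0)).Local v)) → Measure ↥T'),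
      (∀ T ∈ Sell, IsCompact (T : Set (Gqs L v)) ∧ ∃ γ₀ : Gqs L v, IsRegularElt (γ₀.val : GL (Fin 3) (UnitaryGroup.LocalRing L v)) ∧ T = Subgroup.centralizer ({γ₀} : Set (Gqs L v))) →  -- hcartO
      (∀ γ : (Gqs L v), IsRegularElt (γ.val : GL (Fin 3) (UnitaryGroup.LocalRing L v)) → ∃ T' ∈ insert (cmBorelTriple L 3 v).M Sell, ∃ x : (Gqs L v), ∀ g : (Gqs L v), g ∈ Subgroup.centralizer ({γ} : Set (Gqs L v)) ↔ x⁻¹ * g * x ∈ T') →  -- hcovGO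
      (∀ T' ∈ insert (cmBorelTriple L 3 v).M Sell, ∀ T'' ∈ insert (cmBorelTriple L 3 v).M Sell, T' ≠ T'' → ∀ y : (Gqs L v), ¬ ∀ h : (Gqs L v), h ∈ T'' ↔ y⁻¹ * h * y ∈ T') →  -- hncGO
      (∀ T ∈ Sell, (μTf T).IsHaarMeasure) →  -- hHaarGO
      (∀ T' ∈ Sell, μTf T' (compactCore ↥T') = 1) →  -- hcoreGO
      (μTf (cmBorelTriple L 3 v).M).IsHaarMeasure →  -- hHaarMO
      (μTf (cmBorelTriple L 3 v).M (compactCore ↥(cmBorelTriple L 3 v).M) = 1) →  -- hcoreMO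
      (∀ T' ∈ SH, IsCompact (T' : Set ((UnitaryGroup.cmDatum L 2 (Matrix.of fun i j : Fin 2 => if i.val + j.val + 1 = 2 then (1 : L) else 0)).Local v × (UnitaryGroup.cmDatum L 1 (Matrix.of fun i j : Fin 1 => if i.val + j.val + 1 = 1 then (1 : L) else 0)).Local v)) ∧ ∃ γ₀ : ((UnitaryGroup.cmDatum L 2 (Matrix.of fun i j : Fin 2 => if i.val + j.val + 1 = 2 then (1 : L) else 0)).Local v × (UnitaryGroup.cmDatum L 1 (Matrix.of fun i j : Fin 1 => if i.val + j.val + 1 = 1 then (1 : L) else 0)).Local v), IsLocalGRegular L v γ₀ ∧ T' = Subgroup.centralizer ({γ₀} : Set ((UnitaryGroup.cmDatum L 2 (Matrix.of fun i j : Fin 2 => if i.val + j.val + 1 = 2 then (1 : L) else 0)).Local v × (UnitaryGroup.cmDatum L 1 (Matrix.of fun i j : Fin 1 => if i.val + j.val + 1 = 1 then (1 : L) else 0)).Local v))) →  -- hKHO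
      (∀ γ₀ : ((UnitaryGroup.cmDatum L 2 (Matrix.of fun i j : Fin 2 => if i.val + j.val + 1 = 2 then (1 : L) else 0)).Local v × (UnitaryGroup.cmDatum L 1 (Matrix.of fun i j : Fin 1 => if i.val + j.val + 1 = 1 then (1 : L) else 0)).Local v), IsLocalGRegular L v γ₀ → IsCompact ((Subgroup.centralizer ({γ₀} : Set ((UnitaryGroup.cmDatum L 2 (Matrix.of fun i j : Fin 2 => if i.val + j.val + 1 = 2 then (1 : L) else 0)).Local v × (UnitaryGroup.cmDatum L 1 (Matrix.of fun i j : Fin 1 => if i.val + j.val + 1 = 1 then (1 : L) else 0)).Local v)) : Subgroup ((UnitaryGroup.cmDatum L 2 (Matrix.of fun i j : Fin 2 => if i.val + j.val + 1 = 2 then (1 : L) else 0)).Local v × (UnitaryGroup.cmDatum L 1 (Matrix.of fun i j : Fin 1 => if i.val + j.val + 1 = 1 then (1 : L) else 0)).Local v)) : Set ((UnitaryGroup.cmDatum L 2 (Matrix.of fun i j : Fin 2 => if i.val + j.val + 1 = 2 then (1 : L) else 0)).Local v × (UnitaryGroup.cmDatum L 1 (Matrix.of fun i j : Fin 1 =>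 if i.val + j.val + 1 = 1 then (1 : L) else 0)).Local v)) → ∃ T' ∈ SH, ∃ x : ((UnitaryGroup.cmDatum L 2 (Matrix.of fun i j : Fin 2 => if i.val + j.val + 1 = 2 then (1 : L) else 0)).Local v × (UnitaryGroup.cmDatum L 1 (Matrix.of fun i j : Fin 1 => if i.val + j.val + 1 = 1 then (1 : L) else 0)).Local v), Subgroup.centralizer ({x * γ₀ * x⁻¹} : Set ((UnitaryGroup.cmDatum L 2 (Matrix.of fun i j : Fin 2 => if i.val + j.val + 1 = 2 then (1 : L) else 0)).Local v × (UnitaryGroup.cmDatum L 1 (Matrix.of fun i j : Fin 1 => if i.val + j.val + 1 = 1 then (1 : L) else 0)).Local v)) = T') →  -- hcovHO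
      (∀ T' ∈ SH, ∀ T'' ∈ SH, (∃ x : ((UnitaryGroup.cmDatum L 2 (Matrix.of fun i j : Fin 2 => if i.val + j.val + 1 = 2 then (1 : L) else 0)).Local v × (UnitaryGroup.cmDatum L 1 (Matrix.of fun i j : Fin 1 => if i.val + j.val + 1 = 1 then (1 : L) else 0)).Local v), T'.map (MulAut.conj x).toMonoidHom = T'') → T' = T'') →  -- hncHO
      (∀ T' ∈ SH, (μTHf T').IsHaarMeasure) →  -- hHaarHO
      (∀ T' ∈ SH, IsProbabilityMeasure (μTHf T')) →  -- hprobHO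
      ∀ (𝔇 : Ch12Sec5.EllipticData (Gqs L v) ((UnitaryGroup.cmDatum L 2 (Matrix.of fun i j : Fin 2 => if i.val + j.val + 1 = 2 then (1 : L) else 0)).Local v × (UnitaryGroup.cmDatum L 1 (Matrix.of fun i j : Fin 1 => if i.val + j.val + 1 = 1 then (1 : L) else 0)).Local v)) (par : (IrrClass (Gqs L v) → ((((UnitaryGroup.LocalRing L v)ˣ →* ℂˣ) × (↥(normOneUnits (conjLocal L (IsCMField.complexConj L) v)) →* ℂˣ))))),
      𝔇.μG = νQv →  -- hC01
      𝔇.μH = νHv →  -- hC02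
      𝔇.μGZ = μZ →  -- hC03
      𝔇.orb = mQv →  -- hC04
      (∀ γ : Gqs L v, γ ∈ 𝔇.regG ↔ IsRegularElt (γ.val : GL (Fin 3) (UnitaryGroup.LocalRing L v))) →  -- hC05
      (∀ (φ : Gqs L v → ℂ) (fH : ((UnitaryGroup.cmDatum L 2 (Matrix.of fun i j : Fin 2 => if i.val + j.val + 1 = 2 then (1 : L) else 0)).Local v × (UnitaryGroup.cmDatum L 1 (Matrix.of fun i j : Fin 1 => if i.val + j.val + 1 = 1 then (1 : L) else 0)).Local v) → ℂ), 𝔇.IsTransfer φ fH ↔ IsLocalDeltaTransfer L (qsForm L) v ((finExplicitCollection L (qsForm L) μ (finExplicitDelta_conj_left_all L (qsForm L) μ) (finExplicitDelta_conj_right_all L (qsForm L) μ)) v) mHv mQv fH φ) →  -- hC06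
      ({πSt} : Finset (IrrClass (((UnitaryGroup.cmDatum L 2 (Matrix.of fun i j : Fin 2 => if i.val + j.val + 1 = 2 then (1 : L) else 0)).Local v × (UnitaryGroup.cmDatum L 1 (Matrix.of fun i j : Fin 1 => if i.val + j.val + 1 = 1 then (1 : L) else 0)).Local v)))) ∈ 𝔇.sqPacketsH →  -- hC07
      (∀ γ : Gqs L v, γ ∈ 𝔇.ellG ↔ IsRegularElt (γ.val : GL (Fin 3) (UnitaryGroup.LocalRing L v)) ∧ γ ∉ hyperbolicSet L v) →  -- hE
      (∀ π : IrrClass (Gqs L v), Measurable (𝔇.char π) ∧ LocallyIntegrable (𝔇.char π) 𝔇.μG ∧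
      (∀ x ∈ 𝔇.regG, ∀ᶠ y in 𝓝 x, 𝔇.char π y = 𝔇.char π x) ∧
      ∀ φ : Gqs L v → ℂ, IsLocSmooth φ → π.smoothTrace 𝔇.μG φ = ∫ x, φ x * 𝔇.char π x ∂𝔇.μG) →  -- hchar
      (∀ T : Subgroup (Gqs L v), T ∈ 𝔇.cartanAll ↔ T = (cmBorelTriple L 3 v).M ∨ T ∈ 𝔇.cartanG) →  -- hAll
      (𝔇.μT (cmBorelTriple L 3 v).M).IsHaarMeasure →  -- hHaar
      (∀ T ∈ 𝔇.cartanG, IsCompact (T : Set (Gqs L v)) ∧ ∃ γ₀ : Gqs L v, IsRegularElt (γ₀.val : GL (Fin 3) (UnitaryGroup.LocalRing L v)) ∧ T = Subgroup.centralizer ({γ₀} : Set (Gqs L v))) →  -- hcart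
      (∀ T ∈ 𝔇.cartanG, (𝔇.μT T).IsHaarMeasure) →  -- hHaarG
      (∀ T ∈ 𝔇.cartanG, IsFiniteMeasure (𝔇.μT T)) →  -- hfinG
      (∀ T ∈ 𝔇.cartanG, ∃ s : Finset (Subgroup ↥T), (∀ K ∈ s, IsClosed (K : Set ↥T) ∧ ¬ IsOpen (K : Set ↥T)) ∧ ∀ t : ↥T, ¬ IsRegularElt ((t : Gqs L v).val : GL (Fin 3) (UnitaryGroup.LocalRing L v)) → ∃ K ∈ s, t ∈ K) →  -- hker
      (∀ g : Gqs L v, 𝔇.DG g = ((NNReal.sqrt (NNReal.sqrt ((∏ w : PlacesOver L v, IsNonarchimedeanLocalField.normAbs (w.1.adicCompletion L) (((g.val : GL (Fin 3) (UnitaryGroup.LocalRing L v)).val.charpoly.discr) w)) * ((∏ w : PlacesOver L v, IsNonarchimedeanLocalField.normAbs (w.1.adicCompletion L) (((g.val : GL (Fin 3) (UnitaryGroup.LocalRing L v)).val.det) w)) ^ 2)⁻¹)) : NNReal) : ℝ)) →  -- eDG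
      (∀ s : ((UnitaryGroup.cmDatum L 2 (Matrix.of fun i j : Fin 2 => if i.val + j.val + 1 = 2 then (1 : L) else 0)).Local v × (UnitaryGroup.cmDatum L 1 (Matrix.of fun i j : Fin 1 => if i.val + j.val + 1 = 1 then (1 : L) else 0)).Local v), 𝔇.DH s = ((NNReal.sqrt (NNReal.sqrt ((∏ w : PlacesOver L v, IsNonarchimedeanLocalField.normAbs (w.1.adicCompletion L) (((s.1.val : GL (Fin 2) (UnitaryGroup.LocalRing L v)).val.charpoly.discr) w)) * (∏ w : PlacesOver L v, IsNonarchimedeanLocalField.normAbs (w.1.adicCompletion L) (((s.1.val : GL (Fin 2) (UnitaryGroup.LocalRing L v)).val.det) w))⁻¹)) : NNReal) : ℝ)) →  -- eDH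
      (∀ T ∈ 𝔇.cartanH, IsCompact (T : Set ((UnitaryGroup.cmDatum L 2 (Matrix.of fun i j : Fin 2 => if i.val + j.val + 1 = 2 then (1 : L) else 0)).Local v × (UnitaryGroup.cmDatum L 1 (Matrix.of fun i j : Fin 1 => if i.val + j.val + 1 = 1 then (1 : L) else 0)).Local v))) →  -- hKH
      (∀ T ∈ 𝔇.cartanH, IsFiniteMeasure (𝔇.μTH T)) →  -- hFH
      (∀ ρ ∈ 𝔇.sqPacketsH, ∀ T ∈ 𝔇.cartanH, ∀ C : Set ((UnitaryGroup.cmDatum L 2 (Matrix.of fun i j : Fin 2 => if i.val + j.val + 1 = 2 then (1 : L) else 0)).Local v × (UnitaryGroup.cmDatum L 1 (Matrix.of fun i j : Fin 1 => if i.val + j.val + 1 = 1 then (1 : L) else 0)).Local v), IsCompact C → C ⊆ (T : Set ((UnitaryGroup.cmDatum L 2 (Matrix.of fun i j : Fin 2 => if i.val + j.val + 1 = 2 then (1 : L) else 0)).Local v × (UnitaryGroup.cmDatum L 1 (Matrix.of fun i j : Fin 1 => if i.val + j.val + 1 = 1 then (1 : L) else 0)).Local v)) → ∃ B : ℝ,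 ∀ γ ∈ C, ‖(𝔇.DH γ : ℂ) * 𝔇.packetCharH ρ γ‖ ≤ B) →  -- hHBH
      (∀ π : IrrClass (Gqs L v), ¬ π.IsSquareIntegrable μZ → π.IsConstituentOf (UnitaryGroup.cmPrincipalSeries L 3 v (UnitaryGroup.cmTorusCharPair L v (par π).1 (par π).2)) ∧ Continuous (par π).1 ∧ Continuous (par π).2) →  -- hNL
      (∀ π : IrrClass (Gqs L v), (∃ (χ₁ : (UnitaryGroup.LocalRing L v)ˣ →* ℂˣ) (χ₂ : ↥(normOneUnits (conjLocal L (IsCMField.complexConj L) v)) →* ℂˣ), Continuous (fun x => ((χ₁ x : ℂˣ) : ℂ)) ∧ Continuous (fun x => ((χ₂ x : ℂˣ) : ℂ)) ∧ (UnitaryGroup.cmPrincipalSeries L 3 v (UnitaryGroup.cmTorusCharPair L v χ₁ χ₂)).IsIrreducible ∧ π.IsConstituentOf (UnitaryGroup.cmPrincipalSeries L 3 v (UnitaryGroup.cmTorusCharPair L v χ₁ χ₂))) → (UnitaryGroup.cmPrincipalSeries L 3 v (UnitaryGroup.cmTorusCharPair L v (par π).1 (par π).2)).IsIrreducible ∧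 π.IsConstituentOf (UnitaryGroup.cmPrincipalSeries L 3 v (UnitaryGroup.cmTorusCharPair L v (par π).1 (par π).2)) ∧ Continuous (par π).1 ∧ Continuous (par π).2 ∧ Continuous (fun x => (((par π).1 x : ℂˣ) : ℂ)) ∧ Continuous (fun x => (((par π).2 x : ℂˣ) : ℂ)) ∧ ∀ (ν : Measure (Gqs L v)) (f : Gqs L v → ℂ), π.smoothTrace ν f = Representation.smoothTrace (G := Gqs L v) (UnitaryGroup.cmPrincipalSeries L 3 v (UnitaryGroup.cmTorusCharPair L v (par π).1 (par π).2)) ν f) →  -- hPSpar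
      (∀ P : Finset (IrrClass (Gqs L v)), P ∈ 𝔇.ldsPackets ↔ (P.card = 2 ∧ ∃ (χ₁ : (UnitaryGroup.LocalRing L v)ˣ →* ℂˣ) (χ₂ : ↥(normOneUnits (conjLocal L (IsCMField.complexConj L) v)) →* ℂˣ), Continuous (fun x => ((χ₁ x : ℂˣ) : ℂ)) ∧ Continuous (fun x => ((χ₂ x : ℂˣ) : ℂ)) ∧ (∀ a : (UnitaryGroup.LocalRing L v)ˣ, (conjLocal L (IsCMField.complexConj L) v) (a : UnitaryGroup.LocalRing L v) = a → χ₁ a = 1) ∧ χ₁ ≠ 1 ∧ ∀ c : IrrClass (Gqs L v), c ∈ P ↔ c.IsConstituentOf (UnitaryGroup.cmPrincipalSeries L 3 v (UnitaryGroup.cmTorusCharPair L v χ₁ χ₂)))) →  -- hLdsF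
      (∀ (χ₁ : (UnitaryGroup.LocalRing L v)ˣ →* ℂˣ) (χ₂ : ↥(normOneUnits (conjLocal L (IsCMField.complexConj L) v)) →* ℂˣ), Continuous (fun x => ((χ₁ x : ℂˣ) : ℂ)) → Continuous (fun x => ((χ₂ x : ℂˣ) : ℂ)) → ∀ π π' : IrrClass (Gqs L v), ¬ π.IsSquareIntegrable μZ → ¬ π'.IsSquareIntegrable μZ → π.IsConstituentOf (UnitaryGroup.cmPrincipalSeries L 3 v (UnitaryGroup.cmTorusCharPair L v χ₁ χ₂)) → π'.IsConstituentOf (UnitaryGroup.cmPrincipalSeries L 3 v (UnitaryGroup.cmTorusCharPair L v χ₁ χ₂)) → par π = par π') →  -- hW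
      (∀ a b : ((UnitaryGroup.cmDatum L 2 (Matrix.of fun i j : Fin 2 => if i.val + j.val + 1 = 2 then (1 : L) else 0)).Local v × (UnitaryGroup.cmDatum L 1 (Matrix.of fun i j : Fin 1 => if i.val + j.val + 1 = 1 then (1 : L) else 0)).Local v), 𝔇.stConjH a b ↔ IsLocalStablyConjH L v a b) →  -- hStH
      (∀ a : ((UnitaryGroup.cmDatum L 2 (Matrix.of fun i j : Fin 2 => if i.val + j.val + 1 = 2 then (1 : L) else 0)).Local v × (UnitaryGroup.cmDatum L 1 (Matrix.of fun i j : Fin 1 => if i.val + j.val + 1 = 1 then (1 : L) else 0)).Local v), IsLocalGRegular L v a → a ∈ 𝔇.regH) →  -- hRegH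
      (∀ (α : ((UnitaryGroup.cmDatum L 2 (Matrix.of fun i j : Fin 2 => if i.val + j.val + 1 = 2 then (1 : L) else 0)).Local v × (UnitaryGroup.cmDatum L 1 (Matrix.of fun i j : Fin 1 => if i.val + j.val + 1 = 1 then (1 : L) else 0)).Local v) → ℂ) (x : Gqs L v), 𝔇.up α x = if IsRegularElt (x.val : GL (Fin 3) (UnitaryGroup.LocalRing L v)) then ((𝔇.DG x : ℂ))⁻¹ * ∑ᶠ q : Quot (IsLocalStablyConjH L v), (if IsLocalGRegular L v q.out ∧ IsLocalNormPair L (qsForm L) v q.out x then finTau L v q.out μ * (𝔇.DH q.out : ℂ) * ((finKappaAt L v (qsForm L) q.out x : ℤ) : ℂ) * α q.out else 0) else 0) →  -- hUp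
      (∀ ρ ∈ 𝔇.sqPacketsH, ∀ C : Set ((UnitaryGroup.cmDatum L 2 (Matrix.of fun i j : Fin 2 => if i.val + j.val + 1 = 2 then (1 : L) else 0)).Local v × (UnitaryGroup.cmDatum L 1 (Matrix.of fun i j : Fin 1 => if i.val + j.val + 1 = 1 then (1 : L) else 0)).Local v), IsCompact C → ∃ B : ℝ, ∀ s ∈ C, IsLocalGRegular L v s → ‖(𝔇.DH s : ℂ) * 𝔇.packetCharH ρ s‖ ≤ B) →  -- hHBHP
      (∀ ξ' : ((UnitaryGroup.cmDatum L 2 (Matrix.of fun i j : Fin 2 => if i.val + j.val + 1 = 2 then (1 : L) else 0)).Local v × (UnitaryGroup.cmDatum L 1 (Matrix.of fun i j : Fin 1 => if i.val + j.val + 1 = 1 then (1 : L) else 0)).Local v) →* ℂˣ, Continuous ξ' → ∃ (η₁ η₂ : ↥(normOneUnits (conjLocal L (IsCMField.complexConj L) v)) →* ℂˣ), Continuous (fun x => ((η₁ x : ℂˣ) : ℂ)) ∧ Continuous (fun x => ((η₂ x : ℂˣ) : ℂ)) ∧ KeysCaseTwoLabels L v (μ.semilocalComponent L v) η₁ η₂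 (𝔇.pi2 ξ') (𝔇.piN ξ')) →  -- hlabels
      (∀ ψ' : ↥(Subgroup.center (Gqs L v)) →* ℂˣ, Continuous ψ' → ∃ ψ : ↥(normOneUnits (conjLocal L (IsCMField.complexConj L) v)) →* ℂˣ, Continuous ψ ∧ 𝔇.stG ψ' ≠ 𝔇.detG ψ' ∧ ∀ c : IrrClass (Gqs L v), c.IsConstituentOf (UnitaryGroup.cmPrincipalSeries L 3 v (UnitaryGroup.cmTorusCharPair L v (halfModulusChar (UnitaryGroup.LocalRing L v) * halfModulusChar (UnitaryGroup.LocalRing L v))⁻¹ ψ)) ↔ (c = 𝔇.stG ψ' ∨ c = 𝔇.detG ψ')) →  -- hSt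
      (∀ ψ₀ : ↥(normOneUnits (conjLocal L (IsCMField.complexConj L) v)) →* ℂˣ, Continuous (fun x => ((ψ₀ x : ℂˣ) : ℂ)) → ∃ ψ : ↥(Subgroup.center (Gqs L v)) →* ℂˣ, Continuous ψ ∧ ∀ c : IrrClass (Gqs L v), c.IsConstituentOf (UnitaryGroup.cmPrincipalSeries L 3 v (UnitaryGroup.cmTorusCharPair L v (halfModulusChar (UnitaryGroup.LocalRing L v) * halfModulusChar (UnitaryGroup.LocalRing L v))⁻¹ ψ₀)) ↔ (c = 𝔇.stG ψ ∨ c = 𝔇.detG ψ)) →  -- hStJH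
      (∀ (η₁ η₂ : ↥(normOneUnits (conjLocal L (IsCMField.complexConj L) v)) →* ℂˣ), Continuous (fun x => ((η₁ x : ℂˣ) : ℂ)) → Continuous (fun x => ((η₂ x : ℂˣ) : ℂ)) → ∃ ξ' : ((UnitaryGroup.cmDatum L 2 (Matrix.of fun i j : Fin 2 => if i.val + j.val + 1 = 2 then (1 : L) else 0)).Local v × (UnitaryGroup.cmDatum L 1 (Matrix.of fun i j : Fin 1 => if i.val + j.val + 1 = 1 then (1 : L) else 0)).Local v) →* ℂˣ, Continuous ξ' ∧ KeysCaseTwoLabels L v (μ.semilocalComponent L v) η₁ η₂ (𝔇.pi2 ξ') (𝔇.piN ξ')) →  -- hKeysJH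
      (∀ ρ ∈ 𝔇.sqPacketsH, ∀ a : ((UnitaryGroup.cmDatum L 2 (Matrix.of fun i j : Fin 2 => if i.val + j.val + 1 = 2 then (1 : L) else 0)).Local v × (UnitaryGroup.cmDatum L 1 (Matrix.of fun i j : Fin 1 => if i.val + j.val + 1 = 1 then (1 : L) else 0)).Local v), IsLocalGRegular L v a → ∀ᶠ a' in 𝓝 a, 𝔇.packetCharH ρ a' = 𝔇.packetCharH ρ a) →  -- hM1lc
      (∀ γ : Gqs L v, IsRegularElt (γ.val : GL (Fin 3) (UnitaryGroup.LocalRing L v)) → ∃ T' ∈ 𝔇.cartanAll, ∃ x : Gqs L v, ∀ g : Gqs L v, g ∈ Subgroup.centralizer ({γ} : Set (Gqs L v)) ↔ x⁻¹ * g * x ∈ T') →  -- hcovA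
      (∀ T' ∈ 𝔇.cartanAll, ∀ T'' ∈ 𝔇.cartanAll, T' ≠ T'' → ∀ y : Gqs L v, ¬ ∀ h : Gqs L v, h ∈ T'' ↔ y⁻¹ * h * y ∈ T') →  -- hncA
      (∀ T' ∈ 𝔇.cartanAll, T' ≠ (cmBorelTriple L 3 v).M → IsCompact (T' : Set (Gqs L v))) →  -- hcptA
      (∀ T' ∈ 𝔇.cartanAll, (𝔇.μT T').IsInvInvariant) →  -- hinvT
      (∀ T' ∈ 𝔇.cartanAll, 𝔇.μT T' (compactCore ↥T') = 1) →  -- hcoreT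
      (∀ π ∈ 𝔇.irredPS, ∃ (χ₁ : (UnitaryGroup.LocalRing L v)ˣ →* ℂˣ) (χ₂ : ↥(normOneUnits (conjLocal L (IsCMField.complexConj L) v)) →* ℂˣ), Continuous (fun x => ((χ₁ x : ℂˣ) : ℂ)) ∧ Continuous (fun x => ((χ₂ x : ℂˣ) : ℂ)) ∧ (UnitaryGroup.cmPrincipalSeries L 3 v (UnitaryGroup.cmTorusCharPair L v χ₁ χ₂)).IsIrreducible ∧ π.IsConstituentOf (UnitaryGroup.cmPrincipalSeries L 3 v (UnitaryGroup.cmTorusCharPair L v χ₁ χ₂))) →  -- hIrr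
      (∀ ξ' : ((UnitaryGroup.cmDatum L 2 (Matrix.of fun i j : Fin 2 => if i.val + j.val + 1 = 2 then (1 : L) else 0)).Local v × (UnitaryGroup.cmDatum L 1 (Matrix.of fun i j : Fin 1 => if i.val + j.val + 1 = 1 then (1 : L) else 0)).Local v) →* ℂˣ, (𝔇.pi2 ξ').IsSquareIntegrable 𝔇.μGZ ∧ ¬ (𝔇.piN ξ').IsSquareIntegrable 𝔇.μGZ) →  -- hKeys
      𝔇.DetNotL2 →  -- hDet
      𝔇.PacketCharHRegularity →  -- hM1H
      (∀ ψ' : ↥(Subgroup.center (Gqs L v)) →* ℂˣ, Continuous ψ' → 𝔇.IsL2 (𝔇.stG ψ')) →  -- hStL2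
      𝔇.cartanG = Sell →  -- eCartanG
      (∀ T' : Subgroup (Gqs L v), 𝔇.μT T' = μTf T') →  -- eMuT
      𝔇.cartanH = SH →  -- eCartanH
      (∀ T' : Subgroup ((UnitaryGroup.cmDatum L 2 (Matrix.of fun i j : Fin 2 => if i.val + j.val + 1 = 2 then (1 : L) else 0)).Local v × (UnitaryGroup.cmDatum L 1 (Matrix.of fun i j : Fin 1 => if i.val + j.val + 1 = 1 then (1 : L) else 0)).Local v), 𝔇.μTH T' = μTHf T') →  -- eMuTH
      (∀ a : ((UnitaryGroup.cmDatum L 2 (Matrix.of fun i j : Fin 2 => if i.val + j.val + 1 = 2 then (1 : L) else 0)).Local v × (UnitaryGroup.cmDatum L 1 (Matrix.of fun i j : Fin 1 => if i.val + j.val + 1 = 1 then (1 : L) else 0)).Local v), a ∈ 𝔇.regH ↔ IsLocalGRegular L v a) →  -- eRegH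
      (∀ a : ((UnitaryGroup.cmDatum L 2 (Matrix.of fun i j : Fin 2 => if i.val + j.val + 1 = 2 then (1 : L) else 0)).Local v × (UnitaryGroup.cmDatum L 1 (Matrix.of fun i j : Fin 1 => if i.val + j.val + 1 = 1 then (1 : L) else 0)).Local v), a ∈ 𝔇.ellH ↔ IsLocalGRegular L v a ∧ IsCompact ((Subgroup.centralizer ({a} : Set ((UnitaryGroup.cmDatum L 2 (Matrix.of fun i j : Fin 2 => if i.val + j.val + 1 = 2 then (1 : L) else 0)).Local v × (UnitaryGroup.cmDatum L 1 (Matrix.of fun i j : Fin 1 => if i.val + j.val + 1 = 1 then (1 : L) else 0)).Local v)) : Subgroup ((UnitaryGroup.cmDatum L 2 (Matrix.of fun i j : Fin 2 => if i.val + j.val + 1 = 2 then (1 : L) else 0)).Local v × (UnitaryGroup.cmDatum L 1 (Matrix.of fun i j : Fin 1 => if i.val + j.val + 1 = 1 then (1 : L) else 0)).Local v)) : Set ((UnitaryGroup.cmDatum L 2 (Matrix.of fun i j : Fin 2 => if i.val + j.val + 1 = 2 then (1 : L) else 0)).Local v × (UnitaryGroup.cmDatum L 1 (Matrix.of fun i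 j : Fin 1 => if i.val + j.val + 1 = 1 then (1 : L) else 0)).Local v))) →  -- eEllH
      𝔇.sqPacketsH = {({πSt} : Finset (IrrClass ((UnitaryGroup.cmDatum L 2 (Matrix.of fun i j : Fin 2 => if i.val + j.val + 1 = 2 then (1 : L) else 0)).Local v × (UnitaryGroup.cmDatum L 1 (Matrix.of fun i j : Fin 1 => if i.val + j.val + 1 = 1 then (1 : L) else 0)).Local v)))} →  -- eSq
      (∀ π : IrrClass (Gqs L v), (∃ (χ₁ : (UnitaryGroup.LocalRing L v)ˣ →* ℂˣ) (χ₂ : ↥(normOneUnits (conjLocal L (IsCMField.complexConj L) v)) →* ℂˣ), Continuous (fun x => ((χ₁ x : ℂˣ) : ℂ)) ∧ Continuous (fun x => ((χ₂ x : ℂˣ) : ℂ)) ∧ (UnitaryGroup.cmPrincipalSeries L 3 v (UnitaryGroup.cmTorusCharPair L v χ₁ χ₂)).IsIrreducible ∧ π.IsConstituentOf (UnitaryGroup.cmPrincipalSeries L 3 v (UnitaryGroup.cmTorusCharPair L v χ₁ χ₂))) → π ∈ 𝔇.irredPS) →  -- eIrr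
      (∀ (η₁ η₂ : ↥(normOneUnits (conjLocal L (IsCMField.complexConj L) v)) →* ℂˣ), Continuous (fun x => ((η₁ x : ℂˣ) : ℂ)) → Continuous (fun x => ((η₂ x : ℂˣ) : ℂ)) → ∀ ξ' : ((UnitaryGroup.cmDatum L 2 (Matrix.of fun i j : Fin 2 => if i.val + j.val + 1 = 2 then (1 : L) else 0)).Local v × (UnitaryGroup.cmDatum L 1 (Matrix.of fun i j : Fin 1 => if i.val + j.val + 1 = 1 then (1 : L) else 0)).Local v) →* ℂˣ, (∀ hh : ((UnitaryGroup.cmDatum L 2 (Matrix.of fun i j : Fin 2 => if i.val + j.val + 1 = 2 then (1 : L) else 0)).Local v × (UnitaryGroup.cmDatum L 1 (Matrix.of fun i j : Fin 1 => if i.val + j.val + 1 = 1 then (1 : L) else 0)).Local v), ξ' hh = η₁ (localDet (IsCMField.complexConj L) v (isUnit_antidiagOne_det L 2) hh.1) * η₂ (localDet (IsCMField.complexConj L) v (isUnit_antidiagOne_det L 2) hh.1 * localDet (IsCMField.complexConj L) v (isUnit_antidiagOne_det L 1) hh.2)) → KeysCaseTwoLabels L v (μ.semilocalComponent L v) η₁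 η₂ (𝔇.pi2 ξ') (𝔇.piN ξ')) →  -- eLab
      (∀ ρ : IrrClass ((UnitaryGroup.cmDatum L 2 (Matrix.of fun i j : Fin 2 => if i.val + j.val + 1 = 2 then (1 : L) else 0)).Local v × (UnitaryGroup.cmDatum L 1 (Matrix.of fun i j : Fin 1 => if i.val + j.val + 1 = 1 then (1 : L) else 0)).Local v), 𝔇.charH ρ = 𝔇.charH πSt) →  -- eCharH
      (∃ (ιZ : ↥(normOneUnits (conjLocal L (IsCMField.complexConj L) v)) →* ↥(Subgroup.center (Gqs L v))) (detZ : (Gqs L v) →* ↥(Subgroup.center (Gqs L v))), Continuous ιZ ∧ Continuous detZ ∧ (∀ z : ↥(normOneUnits (conjLocal L (IsCMField.complexConj L) v)), ((ιZ z).val.val.val : Matrix (Fin 3) (Fin 3) (UnitaryGroup.LocalRing L v)) = (((z : (UnitaryGroup.LocalRing L v)ˣ) : UnitaryGroup.LocalRing L v)) • (1 : Matrix (Fin 3) (Fin 3) (UnitaryGroup.LocalRing L v))) ∧ (∀ g : (Gqs L v), ((detZ g).val.val.val : Matrix (Fin 3) (Fin 3) (UnitaryGroup.LocalRing L v)) =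 (g.val.val : Matrix (Fin 3) (Fin 3) (UnitaryGroup.LocalRing L v)).det • (1 : Matrix (Fin 3) (Fin 3) (UnitaryGroup.LocalRing L v))) ∧ ∀ ψ : ↥(Subgroup.center (Gqs L v)) →* ℂˣ, Continuous ψ → (∃ hopen : IsOpen (((ψ.comp detZ).ker : Subgroup (Gqs L v)) : Set (Gqs L v)), 𝔇.detG ψ = IrrClass.mk (SmoothIrrep.ofChar (ψ.comp detZ) hopen)) ∧ 𝔇.stG ψ ≠ 𝔇.detG ψ ∧ (∀ c : IrrClass (Gqs L v), c.IsConstituentOf (cmPrincipalSeries L 3 v (cmTorusCharPair L v (halfModulusChar (UnitaryGroup.LocalRing L v) * halfModulusChar (UnitaryGroup.LocalRing L v))⁻¹ (ψ.comp ιZ))) ↔ (c = 𝔇.stG ψ ∨ c = 𝔇.detG ψ)) ∧ (𝔇.stG ψ).IsSquareIntegrable μZ ∧ ¬ (𝔇.detG ψ).IsSquareIntegrable μZ) →  -- eSt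
      ∀ π π' : IrrClass (Gqs L v), 𝔇.IsEllipticRep π → 𝔇.IsEllipticRep π' → ¬ π.IsSupercuspidal → ¬ π'.IsSupercuspidal → ¬ (Algebra.IsUnramifiedIn (𝓞 L) v.asIdeal ∨ Valued.v (2 : v.adicCompletion ↥(maximalRealSubfield L)) = 1) → ¬ ((Algebra.IsUnramifiedIn (𝓞 L) v.asIdeal ∨ Valued.v (2 : v.adicCompletion ↥(maximalRealSubfield L)) = 1) ∧ (∃ ψ : ↥(Subgroup.center (Gqs L v)) →* ℂˣ, Continuous ψ ∧ (π = 𝔇.stG ψ ∨ π = 𝔇.detG ψ)) ∧ (∃ ψ' : ↥(Subgroup.center (Gqs L v)) →* ℂˣ, Continuous ψ' ∧ (π' = 𝔇.stG ψ' ∨ π' = 𝔇.detG ψ'))) → 𝔇.innerG (𝔇.char π) (𝔇.char π') ≠ 0 → π ≠ π' → 𝔇.IsEllipticPair π π') :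
  ∀ (L : Type) [Field L] [NumberField L] [IsCMField L] (μ : HeckeCharacter L) (ξ : OneDimAutRepH L) (v : HeightOneSpectrum (𝓞 ↥(maximalRealSubfield L))),
    (∀ w : PlacesOver L v, IsCMField.complexConj L • w.1 = w.1) → μ.IsUnitary →
    (∀ x : Literature.NumberTheory.GaloisRepresentations.ideleGroup ↥(maximalRealSubfield L),
      μ (AdeleRing.ideleBaseChange (↥(maximalRealSubfield L)) L x) = quadraticHeckeCharCM L x) →
    ∀ [MeasurableSpace (((UnitaryGroup.cmDatum L 2 (Matrix.of fun i j : Fin 2 => if i.val + j.val + 1 = 2 then (1 : L) else 0)).Local v × (UnitaryGroup.cmDatum L 1 (Matrix.of fun i j : Fin 1 => if i.val + j.val + 1 = 1 then (1 : L) else 0)).Local v))] [BorelSpace (((UnitaryGroup.cmDatum L 2 (Matrix.of fun i j : Fin 2 => if i.val + j.val + 1 = 2 then (1 : L) else 0)).Local v × (UnitaryGroup.cmDatum L 1 (Matrix.of fun i j : Fin 1 => if i.val + j.val + 1 = 1 then (1 : L) else 0)).Local v))] [MeasurableSpace (Gqs L v)] [BorelSpace (Gqs L v)]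
      (νHv : Measure (((UnitaryGroup.cmDatum L 2 (Matrix.of fun i j : Fin 2 => if i.val + j.val + 1 = 2 then (1 : L) else 0)).Local v × (UnitaryGroup.cmDatum L 1 (Matrix.of fun i j : Fin 1 => if i.val + j.val + 1 = 1 then (1 : L) else 0)).Local v))) (νQv : Measure (Gqs L v))
      [νHv.IsHaarMeasure] [νHv.IsMulRightInvariant] [νQv.IsHaarMeasure] [νQv.IsMulRightInvariant],
    letI : ∀ a : ((UnitaryGroup.cmDatum L 2 (Matrix.of fun i j : Fin 2 => if i.val + j.val + 1 = 2 then (1 : L) else 0)).Local v × (UnitaryGroup.cmDatum L 1 (Matrix.of fun i j : Fin 1 => if i.val + j.val + 1 = 1 then (1 : L) else 0)).Local v), MeasurableSpace (((UnitaryGroup.cmDatum L 2 (Matrix.of fun i j : Fin 2 => if i.val + j.val + 1 = 2 then (1 : L) else 0)).Local v × (UnitaryGroup.cmDatum L 1 (Matrix.of fun i j : Fin 1 => if i.val + j.val + 1 = 1 then (1 : L) else 0)).Local v) ⧸ Subgroup.centralizer ({a} : Set (((UnitaryGroup.cmDatum L 2 (Matrix.of fun i j : Fin 2 => if i.val + j.val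 + 1 = 2 then (1 : L) else 0)).Local v × (UnitaryGroup.cmDatum L 1 (Matrix.of fun i j : Fin 1 => if i.val + j.val + 1 = 1 then (1 : L) else 0)).Local v)))) := fun _ => borel _
    haveI : ∀ a : ((UnitaryGroup.cmDatum L 2 (Matrix.of fun i j : Fin 2 => if i.val + j.val + 1 = 2 then (1 : L) else 0)).Local v × (UnitaryGroup.cmDatum L 1 (Matrix.of fun i j : Fin 1 => if i.val + j.val + 1 = 1 then (1 : L) else 0)).Local v), BorelSpace (((UnitaryGroup.cmDatum L 2 (Matrix.of fun i j : Fin 2 => if i.val + j.val + 1 = 2 then (1 : L) else 0)).Local v × (UnitaryGroup.cmDatum L 1 (Matrix.of fun i j : Fin 1 => if i.val + j.val + 1 = 1 then (1 : L) else 0)).Local v) ⧸ Subgroup.centralizer ({a} : Set (((UnitaryGroup.cmDatum L 2 (Matrix.of fun i j : Fin 2 => if i.val + j.val + 1 = 2 then (1 : L) else 0)).Local v × (UnitaryGroup.cmDatum L 1 (Matrix.of fun i j : Fin 1 => if i.val + j.val + 1 = 1 then (1 : L) else 0)).Local v)))) := fun _ => ⟨rfl⟩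
    letI : ∀ γ : Gqs L v, MeasurableSpace (Gqs L v ⧸ Subgroup.centralizer ({γ} : Set (Gqs L v))) := fun _ => borel _
    haveI : ∀ γ : Gqs L v, BorelSpace (Gqs L v ⧸ Subgroup.centralizer ({γ} : Set (Gqs L v))) := fun _ => ⟨rfl⟩
    ∀ (mHv : OrbitalMeasureFamily (((UnitaryGroup.cmDatum L 2 (Matrix.of fun i j : Fin 2 => if i.val + j.val + 1 = 2 then (1 : L) else 0)).Local v × (UnitaryGroup.cmDatum L 1 (Matrix.of fun i j : Fin 1 => if i.val + j.val + 1 = 1 then (1 : L) else 0)).Local v))) (mQv : OrbitalMeasureFamily (Gqs L v)),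
      mHv.IsCanonical (IsLocalGRegular L v) νHv →
      mQv.IsCanonical (fun γ => IsRegularElt (γ.val : GL (Fin 3) (UnitaryGroup.LocalRing L v))) νQv →
      IsLocalDeltaTransferExists L (qsForm L) v ((finExplicitCollection L (qsForm L) μ (finExplicitDelta_conj_left_all L (qsForm L) μ) (finExplicitDelta_conj_right_all L (qsForm L) μ)) v) mHv mQv IsLocSmooth IsLocSmooth →
      ∀ (π₁ πSt : IrrClass (((UnitaryGroup.cmDatum L 2 (Matrix.of fun i j : Fin 2 => if i.val + j.val + 1 = 2 then (1 : L) else 0)).Local v × (UnitaryGroup.cmDatum L 1 (Matrix.of fun i j : Fin 1 => if i.val + j.val + 1 = 1 then (1 : L) else 0)).Local v))),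
        HLengthTwoLabels L v
          (torusCharPair (conjLocal L (IsCMField.complexConj L) v) (cmLocalForm L 2 v) (cmLocalForm_eq_over L 2 v) 0
            ((torusLocalComponent L (IsCMField.complexConj L) v ξ.η).comp
                (quotConj (conjLocal L (IsCMField.complexConj L) v) (conjLocal_conjLocal_cm L v)) *
              halfModulusChar (UnitaryGroup.LocalRing L v))
            (torusLocalComponent L (IsCMField.complexConj L) v ξ.ψ))
          ((torusLocalComponent L (IsCMField.complexConj L) v ξ.ψ).comp (localDet (IsCMField.complexConj L) v (isUnit_antidiagOne_det L 1))) π₁ πSt →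
        (∀ fH : ((UnitaryGroup.cmDatum L 2 (Matrix.of fun i j : Fin 2 => if i.val + j.val + 1 = 2 then (1 : L) else 0)).Local v × (UnitaryGroup.cmDatum L 1 (Matrix.of fun i j : Fin 1 => if i.val + j.val + 1 = 1 then (1 : L) else 0)).Local v) → ℂ, IsLocSmooth fH → π₁.smoothTrace νHv fH = charDist (ξ.xiLocalChar v) νHv fH) →
      ∀ [MeasurableSpace (Gqs L v ⧸ Subgroup.center (Gqs L v))] [BorelSpace (Gqs L v ⧸ Subgroup.center (Gqs L v))]
        (μZ : Measure (Gqs L v ⧸ Subgroup.center (Gqs L v))) [μZ.IsHaarMeasure],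
      ∀ (Sell : Finset (Subgroup (Gqs L v))) (μTf : (T' : Subgroup (Gqs L v)) → Measure ↥T') (SH : Finset (Subgroup ((UnitaryGroup.cmDatum L 2 (Matrix.of fun i j : Fin 2 => if i.val + j.val + 1 = 2 then (1 : L) else 0)).Local v × (UnitaryGroup.cmDatum L 1 (Matrix.of fun i j : Fin 1 => if i.val + j.val + 1 = 1 then (1 : L) else 0)).Local v))) (μTHf : (T' : Subgroup ((UnitaryGroup.cmDatum L 2 (Matrix.of fun i j : Fin 2 => if i.val + j.val + 1 = 2 then (1 : L) else 0)).Local v × (UnitaryGroup.cmDatum L 1 (Matrix.of fun i j : Fin 1 => if i.val + j.val + 1 = 1 then (1 : L) else 0)).Local v)) → Measure ↥T'),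
        (∀ T ∈ Sell, IsCompact (T : Set (Gqs L v)) ∧ ∃ γ₀ : Gqs L v, IsRegularElt (γ₀.val : GL (Fin 3) (UnitaryGroup.LocalRing L v)) ∧ T = Subgroup.centralizer ({γ₀} : Set (Gqs L v))) →  -- hcartO
        (∀ γ : (Gqs L v), IsRegularElt (γ.val : GL (Fin 3) (UnitaryGroup.LocalRing L v)) → ∃ T' ∈ insert (cmBorelTriple L 3 v).M Sell, ∃ x : (Gqs L v), ∀ g : (Gqs L v), g ∈ Subgroup.centralizer ({γ} : Set (Gqs L v)) ↔ x⁻¹ * g * x ∈ T') →  -- hcovGO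
        (∀ T' ∈ insert (cmBorelTriple L 3 v).M Sell, ∀ T'' ∈ insert (cmBorelTriple L 3 v).M Sell, T' ≠ T'' → ∀ y : (Gqs L v), ¬ ∀ h : (Gqs L v), h ∈ T'' ↔ y⁻¹ * h * y ∈ T') →  -- hncGO
        (∀ T ∈ Sell, (μTf T).IsHaarMeasure) →  -- hHaarGO
        (∀ T' ∈ Sell, μTf T' (compactCore ↥T') = 1) →  -- hcoreGO
        (μTf (cmBorelTriple L 3 v).M).IsHaarMeasure →  -- hHaarMO
        (μTf (cmBorelTriple L 3 v).M (compactCore ↥(cmBorelTriple L 3 v).M) = 1) →  -- hcoreMO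
        (∀ T' ∈ SH, IsCompact (T' : Set ((UnitaryGroup.cmDatum L 2 (Matrix.of fun i j : Fin 2 => if i.val + j.val + 1 = 2 then (1 : L) else 0)).Local v × (UnitaryGroup.cmDatum L 1 (Matrix.of fun i j : Fin 1 => if i.val + j.val + 1 = 1 then (1 : L) else 0)).Local v)) ∧ ∃ γ₀ : ((UnitaryGroup.cmDatum L 2 (Matrix.of fun i j : Fin 2 => if i.val + j.val + 1 = 2 then (1 : L) else 0)).Local v × (UnitaryGroup.cmDatum L 1 (Matrix.of fun i j : Fin 1 => if i.val + j.val + 1 = 1 then (1 : L) else 0)).Local v), IsLocalGRegular L v γ₀ ∧ T' = Subgroup.centralizer ({γ₀} : Set ((UnitaryGroup.cmDatum L 2 (Matrix.of fun i j : Fin 2 => if i.val + j.val + 1 = 2 then (1 : L) else 0)).Local v × (UnitaryGroup.cmDatum L 1 (Matrix.of fun i j : Fin 1 => if i.val + j.val + 1 = 1 then (1 : L) else 0)).Local v))) →  -- hKHO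
        (∀ γ₀ : ((UnitaryGroup.cmDatum L 2 (Matrix.of fun i j : Fin 2 => if i.val + j.val + 1 = 2 then (1 : L) else 0)).Local v × (UnitaryGroup.cmDatum L 1 (Matrix.of fun i j : Fin 1 => if i.val + j.val + 1 = 1 then (1 : L) else 0)).Local v), IsLocalGRegular L v γ₀ → IsCompact ((Subgroup.centralizer ({γ₀} : Set ((UnitaryGroup.cmDatum L 2 (Matrix.of fun i j : Fin 2 => if i.val + j.val + 1 = 2 then (1 : L) else 0)).Local v × (UnitaryGroup.cmDatum L 1 (Matrix.of fun i j : Fin 1 => if i.val + j.val + 1 = 1 then (1 : L) else 0)).Local v)) : Subgroup ((UnitaryGroup.cmDatum L 2 (Matrix.of fun i j : Fin 2 => if i.val + j.val + 1 = 2 then (1 : L) else 0)).Local v × (UnitaryGroup.cmDatum L 1 (Matrix.of fun i j : Fin 1 => if i.val + j.val + 1 = 1 then (1 : L) else 0)).Local v)) : Set ((UnitaryGroup.cmDatum L 2 (Matrix.of fun i j : Fin 2 => if i.val + j.val + 1 = 2 then (1 : L) else 0)).Local v × (UnitaryGroup.cmDatum L 1 (Matrix.of fun i j : Fin 1 =>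 if i.val + j.val + 1 = 1 then (1 : L) else 0)).Local v)) → ∃ T' ∈ SH, ∃ x : ((UnitaryGroup.cmDatum L 2 (Matrix.of fun i j : Fin 2 => if i.val + j.val + 1 = 2 then (1 : L) else 0)).Local v × (UnitaryGroup.cmDatum L 1 (Matrix.of fun i j : Fin 1 => if i.val + j.val + 1 = 1 then (1 : L) else 0)).Local v), Subgroup.centralizer ({x * γ₀ * x⁻¹} : Set ((UnitaryGroup.cmDatum L 2 (Matrix.of fun i j : Fin 2 => if i.val + j.val + 1 = 2 then (1 : L) else 0)).Local v × (UnitaryGroup.cmDatum L 1 (Matrix.of fun i j : Fin 1 => if i.val + j.val + 1 = 1 then (1 : L) else 0)).Local v)) = T') →  -- hcovHO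
        (∀ T' ∈ SH, ∀ T'' ∈ SH, (∃ x : ((UnitaryGroup.cmDatum L 2 (Matrix.of fun i j : Fin 2 => if i.val + j.val + 1 = 2 then (1 : L) else 0)).Local v × (UnitaryGroup.cmDatum L 1 (Matrix.of fun i j : Fin 1 => if i.val + j.val + 1 = 1 then (1 : L) else 0)).Local v), T'.map (MulAut.conj x).toMonoidHom = T'') → T' = T'') →  -- hncHO
        (∀ T' ∈ SH, (μTHf T').IsHaarMeasure) →  -- hHaarHO
        (∀ T' ∈ SH, IsProbabilityMeasure (μTHf T')) →  -- hprobHO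
        ∀ (𝔇 : Ch12Sec5.EllipticData (Gqs L v) ((UnitaryGroup.cmDatum L 2 (Matrix.of fun i j : Fin 2 => if i.val + j.val + 1 = 2 then (1 : L) else 0)).Local v × (UnitaryGroup.cmDatum L 1 (Matrix.of fun i j : Fin 1 => if i.val + j.val + 1 = 1 then (1 : L) else 0)).Local v)) (par : (IrrClass (Gqs L v) → ((((UnitaryGroup.LocalRing L v)ˣ →* ℂˣ) × (↥(normOneUnits (conjLocal L (IsCMField.complexConj L) v)) →* ℂˣ))))),
          𝔇.μG = νQv →  -- hC01
          𝔇.μH = νHv →  -- hC02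
          𝔇.μGZ = μZ →  -- hC03
          𝔇.orb = mQv →  -- hC04
          (∀ γ : Gqs L v, γ ∈ 𝔇.regG ↔ IsRegularElt (γ.val : GL (Fin 3) (UnitaryGroup.LocalRing L v))) →  -- hC05
          (∀ (φ : Gqs L v → ℂ) (fH : ((UnitaryGroup.cmDatum L 2 (Matrix.of fun i j : Fin 2 => if i.val + j.val + 1 = 2 then (1 : L) else 0)).Local v × (UnitaryGroup.cmDatum L 1 (Matrix.of fun i j : Fin 1 => if i.val + j.val + 1 = 1 then (1 : L) else 0)).Local v) → ℂ), 𝔇.IsTransfer φ fH ↔ IsLocalDeltaTransfer L (qsForm L) v ((finExplicitCollection L (qsForm L) μ (finExplicitDelta_conj_left_all L (qsForm L) μ) (finExplicitDelta_conj_right_all L (qsForm L) μ)) v) mHv mQv fH φ) →  -- hC06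
          ({πSt} : Finset (IrrClass (((UnitaryGroup.cmDatum L 2 (Matrix.of fun i j : Fin 2 => if i.val + j.val + 1 = 2 then (1 : L) else 0)).Local v × (UnitaryGroup.cmDatum L 1 (Matrix.of fun i j : Fin 1 => if i.val + j.val + 1 = 1 then (1 : L) else 0)).Local v)))) ∈ 𝔇.sqPacketsH →  -- hC07
          (∀ γ : Gqs L v, γ ∈ 𝔇.ellG ↔ IsRegularElt (γ.val : GL (Fin 3) (UnitaryGroup.LocalRing L v)) ∧ γ ∉ hyperbolicSet L v) →  -- hE
          (∀ π : IrrClass (Gqs L v), Measurable (𝔇.char π) ∧ LocallyIntegrable (𝔇.char π) 𝔇.μG ∧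
          (∀ x ∈ 𝔇.regG, ∀ᶠ y in 𝓝 x, 𝔇.char π y = 𝔇.char π x) ∧
          ∀ φ : Gqs L v → ℂ, IsLocSmooth φ → π.smoothTrace 𝔇.μG φ = ∫ x, φ x * 𝔇.char π x ∂𝔇.μG) →  -- hchar
          (∀ T : Subgroup (Gqs L v), T ∈ 𝔇.cartanAll ↔ T = (cmBorelTriple L 3 v).M ∨ T ∈ 𝔇.cartanG) →  -- hAll
          (𝔇.μT (cmBorelTriple L 3 v).M).IsHaarMeasure →  -- hHaar
          (∀ T ∈ 𝔇.cartanG, IsCompact (T : Set (Gqs L v)) ∧ ∃ γ₀ : Gqs L v, IsRegularElt (γ₀.val : GL (Fin 3) (UnitaryGroup.LocalRing L v)) ∧ T = Subgroup.centralizer ({γ₀} : Set (Gqs L v))) →  -- hcart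
          (∀ T ∈ 𝔇.cartanG, (𝔇.μT T).IsHaarMeasure) →  -- hHaarG
          (∀ T ∈ 𝔇.cartanG, IsFiniteMeasure (𝔇.μT T)) →  -- hfinG
          (∀ T ∈ 𝔇.cartanG, ∃ s : Finset (Subgroup ↥T), (∀ K ∈ s, IsClosed (K : Set ↥T) ∧ ¬ IsOpen (K : Set ↥T)) ∧ ∀ t : ↥T, ¬ IsRegularElt ((t : Gqs L v).val : GL (Fin 3) (UnitaryGroup.LocalRing L v)) → ∃ K ∈ s, t ∈ K) →  -- hker
          (∀ g : Gqs L v, 𝔇.DG g = ((NNReal.sqrt (NNReal.sqrt ((∏ w : PlacesOver L v, IsNonarchimedeanLocalField.normAbs (w.1.adicCompletion L) (((g.val : GL (Fin 3) (UnitaryGroup.LocalRing L v)).val.charpoly.discr) w)) * ((∏ w : PlacesOver L v, IsNonarchimedeanLocalField.normAbs (w.1.adicCompletion L) (((g.val : GL (Fin 3) (UnitaryGroup.LocalRing L v)).val.det) w)) ^ 2)⁻¹)) : NNReal) : ℝ)) →  -- eDG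
          (∀ s : ((UnitaryGroup.cmDatum L 2 (Matrix.of fun i j : Fin 2 => if i.val + j.val + 1 = 2 then (1 : L) else 0)).Local v × (UnitaryGroup.cmDatum L 1 (Matrix.of fun i j : Fin 1 => if i.val + j.val + 1 = 1 then (1 : L) else 0)).Local v), 𝔇.DH s = ((NNReal.sqrt (NNReal.sqrt ((∏ w : PlacesOver L v, IsNonarchimedeanLocalField.normAbs (w.1.adicCompletion L) (((s.1.val : GL (Fin 2) (UnitaryGroup.LocalRing L v)).val.charpoly.discr) w)) * (∏ w : PlacesOver L v, IsNonarchimedeanLocalField.normAbs (w.1.adicCompletion L) (((s.1.val : GL (Fin 2) (UnitaryGroup.LocalRing L v)).val.det) w))⁻¹)) : NNReal) : ℝ)) →  -- eDH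
          (∀ T ∈ 𝔇.cartanH, IsCompact (T : Set ((UnitaryGroup.cmDatum L 2 (Matrix.of fun i j : Fin 2 => if i.val + j.val + 1 = 2 then (1 : L) else 0)).Local v × (UnitaryGroup.cmDatum L 1 (Matrix.of fun i j : Fin 1 => if i.val + j.val + 1 = 1 then (1 : L) else 0)).Local v))) →  -- hKH
          (∀ T ∈ 𝔇.cartanH, IsFiniteMeasure (𝔇.μTH T)) →  -- hFH
          (∀ ρ ∈ 𝔇.sqPacketsH, ∀ T ∈ 𝔇.cartanH, ∀ C : Set ((UnitaryGroup.cmDatum L 2 (Matrix.of fun i j : Fin 2 => if i.val + j.val + 1 = 2 then (1 : L) else 0)).Local v × (UnitaryGroup.cmDatum L 1 (Matrix.of fun i j : Fin 1 => if i.val + j.val + 1 = 1 then (1 : L) else 0)).Local v), IsCompact C → C ⊆ (T : Set ((UnitaryGroup.cmDatum L 2 (Matrix.of fun i j : Fin 2 => if i.val + j.val + 1 = 2 then (1 : L) else 0)).Local v × (UnitaryGroup.cmDatum L 1 (Matrix.of fun i j : Fin 1 => if i.val + j.val + 1 = 1 then (1 : L) else 0)).Local v)) → ∃ B : ℝ,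 ∀ γ ∈ C, ‖(𝔇.DH γ : ℂ) * 𝔇.packetCharH ρ γ‖ ≤ B) →  -- hHBH
          (∀ π : IrrClass (Gqs L v), ¬ π.IsSquareIntegrable μZ → π.IsConstituentOf (UnitaryGroup.cmPrincipalSeries L 3 v (UnitaryGroup.cmTorusCharPair L v (par π).1 (par π).2)) ∧ Continuous (par π).1 ∧ Continuous (par π).2) →  -- hNL
          (∀ π : IrrClass (Gqs L v), (∃ (χ₁ : (UnitaryGroup.LocalRing L v)ˣ →* ℂˣ) (χ₂ : ↥(normOneUnits (conjLocal L (IsCMField.complexConj L) v)) →* ℂˣ), Continuous (fun x => ((χ₁ x : ℂˣ) : ℂ)) ∧ Continuous (fun x => ((χ₂ x : ℂˣ) : ℂ)) ∧ (UnitaryGroup.cmPrincipalSeries L 3 v (UnitaryGroup.cmTorusCharPair L v χ₁ χ₂)).IsIrreducible ∧ π.IsConstituentOf (UnitaryGroup.cmPrincipalSeries L 3 v (UnitaryGroup.cmTorusCharPair L v χ₁ χ₂))) → (UnitaryGroup.cmPrincipalSeries L 3 v (UnitaryGroup.cmTorusCharPair L v (par π).1 (par π).2)).IsIrreducible ∧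 π.IsConstituentOf (UnitaryGroup.cmPrincipalSeries L 3 v (UnitaryGroup.cmTorusCharPair L v (par π).1 (par π).2)) ∧ Continuous (par π).1 ∧ Continuous (par π).2 ∧ Continuous (fun x => (((par π).1 x : ℂˣ) : ℂ)) ∧ Continuous (fun x => (((par π).2 x : ℂˣ) : ℂ)) ∧ ∀ (ν : Measure (Gqs L v)) (f : Gqs L v → ℂ), π.smoothTrace ν f = Representation.smoothTrace (G := Gqs L v) (UnitaryGroup.cmPrincipalSeries L 3 v (UnitaryGroup.cmTorusCharPair L v (par π).1 (par π).2)) ν f) →  -- hPSpar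
          (∀ P : Finset (IrrClass (Gqs L v)), P ∈ 𝔇.ldsPackets ↔ (P.card = 2 ∧ ∃ (χ₁ : (UnitaryGroup.LocalRing L v)ˣ →* ℂˣ) (χ₂ : ↥(normOneUnits (conjLocal L (IsCMField.complexConj L) v)) →* ℂˣ), Continuous (fun x => ((χ₁ x : ℂˣ) : ℂ)) ∧ Continuous (fun x => ((χ₂ x : ℂˣ) : ℂ)) ∧ (∀ a : (UnitaryGroup.LocalRing L v)ˣ, (conjLocal L (IsCMField.complexConj L) v) (a : UnitaryGroup.LocalRing L v) = a → χ₁ a = 1) ∧ χ₁ ≠ 1 ∧ ∀ c : IrrClass (Gqs L v), c ∈ P ↔ c.IsConstituentOf (UnitaryGroup.cmPrincipalSeries L 3 v (UnitaryGroup.cmTorusCharPair L v χ₁ χ₂)))) →  -- hLdsF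
          (∀ (χ₁ : (UnitaryGroup.LocalRing L v)ˣ →* ℂˣ) (χ₂ : ↥(normOneUnits (conjLocal L (IsCMField.complexConj L) v)) →* ℂˣ), Continuous (fun x => ((χ₁ x : ℂˣ) : ℂ)) → Continuous (fun x => ((χ₂ x : ℂˣ) : ℂ)) → ∀ π π' : IrrClass (Gqs L v), ¬ π.IsSquareIntegrable μZ → ¬ π'.IsSquareIntegrable μZ → π.IsConstituentOf (UnitaryGroup.cmPrincipalSeries L 3 v (UnitaryGroup.cmTorusCharPair L v χ₁ χ₂)) → π'.IsConstituentOf (UnitaryGroup.cmPrincipalSeries L 3 v (UnitaryGroup.cmTorusCharPair L v χ₁ χ₂)) → par π = par π') →  -- hW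
          (∀ a b : ((UnitaryGroup.cmDatum L 2 (Matrix.of fun i j : Fin 2 => if i.val + j.val + 1 = 2 then (1 : L) else 0)).Local v × (UnitaryGroup.cmDatum L 1 (Matrix.of fun i j : Fin 1 => if i.val + j.val + 1 = 1 then (1 : L) else 0)).Local v), 𝔇.stConjH a b ↔ IsLocalStablyConjH L v a b) →  -- hStH
          (∀ a : ((UnitaryGroup.cmDatum L 2 (Matrix.of fun i j : Fin 2 => if i.val + j.val + 1 = 2 then (1 : L) else 0)).Local v × (UnitaryGroup.cmDatum L 1 (Matrix.of fun i j : Fin 1 => if i.val + j.val + 1 = 1 then (1 : L) else 0)).Local v), IsLocalGRegular L v a → a ∈ 𝔇.regH) →  -- hRegH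
          (∀ (α : ((UnitaryGroup.cmDatum L 2 (Matrix.of fun i j : Fin 2 => if i.val + j.val + 1 = 2 then (1 : L) else 0)).Local v × (UnitaryGroup.cmDatum L 1 (Matrix.of fun i j : Fin 1 => if i.val + j.val + 1 = 1 then (1 : L) else 0)).Local v) → ℂ) (x : Gqs L v), 𝔇.up α x = if IsRegularElt (x.val : GL (Fin 3) (UnitaryGroup.LocalRing L v)) then ((𝔇.DG x : ℂ))⁻¹ * ∑ᶠ q : Quot (IsLocalStablyConjH L v), (if IsLocalGRegular L v q.out ∧ IsLocalNormPair L (qsForm L) v q.out x then finTau L v q.out μ * (𝔇.DH q.out : ℂ) * ((finKappaAt L v (qsForm L) q.out x : ℤ) : ℂ) * α q.out else 0) else 0) →  -- hUp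
          (∀ ρ ∈ 𝔇.sqPacketsH, ∀ C : Set ((UnitaryGroup.cmDatum L 2 (Matrix.of fun i j : Fin 2 => if i.val + j.val + 1 = 2 then (1 : L) else 0)).Local v × (UnitaryGroup.cmDatum L 1 (Matrix.of fun i j : Fin 1 => if i.val + j.val + 1 = 1 then (1 : L) else 0)).Local v), IsCompact C → ∃ B : ℝ, ∀ s ∈ C, IsLocalGRegular L v s → ‖(𝔇.DH s : ℂ) * 𝔇.packetCharH ρ s‖ ≤ B) →  -- hHBHP
          (∀ ξ' : ((UnitaryGroup.cmDatum L 2 (Matrix.of fun i j : Fin 2 => if i.val + j.val + 1 = 2 then (1 : L) else 0)).Local v × (UnitaryGroup.cmDatum L 1 (Matrix.of fun i j : Fin 1 => if i.val + j.val + 1 = 1 then (1 : L) else 0)).Local v) →* ℂˣ, Continuous ξ' → ∃ (η₁ η₂ : ↥(normOneUnits (conjLocal L (IsCMField.complexConj L) v)) →* ℂˣ), Continuous (fun x => ((η₁ x : ℂˣ) : ℂ)) ∧ Continuous (fun x => ((η₂ x : ℂˣ) : ℂ)) ∧ KeysCaseTwoLabels L v (μ.semilocalComponent L v) η₁ η₂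 (𝔇.pi2 ξ') (𝔇.piN ξ')) →  -- hlabels
          (∀ ψ' : ↥(Subgroup.center (Gqs L v)) →* ℂˣ, Continuous ψ' → ∃ ψ : ↥(normOneUnits (conjLocal L (IsCMField.complexConj L) v)) →* ℂˣ, Continuous ψ ∧ 𝔇.stG ψ' ≠ 𝔇.detG ψ' ∧ ∀ c : IrrClass (Gqs L v), c.IsConstituentOf (UnitaryGroup.cmPrincipalSeries L 3 v (UnitaryGroup.cmTorusCharPair L v (halfModulusChar (UnitaryGroup.LocalRing L v) * halfModulusChar (UnitaryGroup.LocalRing L v))⁻¹ ψ)) ↔ (c = 𝔇.stG ψ' ∨ c = 𝔇.detG ψ')) →  -- hSt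
          (∀ ψ₀ : ↥(normOneUnits (conjLocal L (IsCMField.complexConj L) v)) →* ℂˣ, Continuous (fun x => ((ψ₀ x : ℂˣ) : ℂ)) → ∃ ψ : ↥(Subgroup.center (Gqs L v)) →* ℂˣ, Continuous ψ ∧ ∀ c : IrrClass (Gqs L v), c.IsConstituentOf (UnitaryGroup.cmPrincipalSeries L 3 v (UnitaryGroup.cmTorusCharPair L v (halfModulusChar (UnitaryGroup.LocalRing L v) * halfModulusChar (UnitaryGroup.LocalRing L v))⁻¹ ψ₀)) ↔ (c = 𝔇.stG ψ ∨ c = 𝔇.detG ψ)) →  -- hStJH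
          (∀ (η₁ η₂ : ↥(normOneUnits (conjLocal L (IsCMField.complexConj L) v)) →* ℂˣ), Continuous (fun x => ((η₁ x : ℂˣ) : ℂ)) → Continuous (fun x => ((η₂ x : ℂˣ) : ℂ)) → ∃ ξ' : ((UnitaryGroup.cmDatum L 2 (Matrix.of fun i j : Fin 2 => if i.val + j.val + 1 = 2 then (1 : L) else 0)).Local v × (UnitaryGroup.cmDatum L 1 (Matrix.of fun i j : Fin 1 => if i.val + j.val + 1 = 1 then (1 : L) else 0)).Local v) →* ℂˣ, Continuous ξ' ∧ KeysCaseTwoLabels L v (μ.semilocalComponent L v) η₁ η₂ (𝔇.pi2 ξ') (𝔇.piN ξ')) →  -- hKeysJH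
          (∀ ρ ∈ 𝔇.sqPacketsH, ∀ a : ((UnitaryGroup.cmDatum L 2 (Matrix.of fun i j : Fin 2 => if i.val + j.val + 1 = 2 then (1 : L) else 0)).Local v × (UnitaryGroup.cmDatum L 1 (Matrix.of fun i j : Fin 1 => if i.val + j.val + 1 = 1 then (1 : L) else 0)).Local v), IsLocalGRegular L v a → ∀ᶠ a' in 𝓝 a, 𝔇.packetCharH ρ a' = 𝔇.packetCharH ρ a) →  -- hM1lc
          (∀ γ : Gqs L v, IsRegularElt (γ.val : GL (Fin 3) (UnitaryGroup.LocalRing L v)) → ∃ T' ∈ 𝔇.cartanAll, ∃ x : Gqs L v, ∀ g : Gqs L v, g ∈ Subgroup.centralizer ({γ} : Set (Gqs L v)) ↔ x⁻¹ * g * x ∈ T') →  -- hcovA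
          (∀ T' ∈ 𝔇.cartanAll, ∀ T'' ∈ 𝔇.cartanAll, T' ≠ T'' → ∀ y : Gqs L v, ¬ ∀ h : Gqs L v, h ∈ T'' ↔ y⁻¹ * h * y ∈ T') →  -- hncA
          (∀ T' ∈ 𝔇.cartanAll, T' ≠ (cmBorelTriple L 3 v).M → IsCompact (T' : Set (Gqs L v))) →  -- hcptA
          (∀ T' ∈ 𝔇.cartanAll, (𝔇.μT T').IsInvInvariant) →  -- hinvT
          (∀ T' ∈ 𝔇.cartanAll, 𝔇.μT T' (compactCore ↥T') = 1) →  -- hcoreT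
          (∀ π ∈ 𝔇.irredPS, ∃ (χ₁ : (UnitaryGroup.LocalRing L v)ˣ →* ℂˣ) (χ₂ : ↥(normOneUnits (conjLocal L (IsCMField.complexConj L) v)) →* ℂˣ), Continuous (fun x => ((χ₁ x : ℂˣ) : ℂ)) ∧ Continuous (fun x => ((χ₂ x : ℂˣ) : ℂ)) ∧ (UnitaryGroup.cmPrincipalSeries L 3 v (UnitaryGroup.cmTorusCharPair L v χ₁ χ₂)).IsIrreducible ∧ π.IsConstituentOf (UnitaryGroup.cmPrincipalSeries L 3 v (UnitaryGroup.cmTorusCharPair L v χ₁ χ₂))) →  -- hIrr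
          (∀ ξ' : ((UnitaryGroup.cmDatum L 2 (Matrix.of fun i j : Fin 2 => if i.val + j.val + 1 = 2 then (1 : L) else 0)).Local v × (UnitaryGroup.cmDatum L 1 (Matrix.of fun i j : Fin 1 => if i.val + j.val + 1 = 1 then (1 : L) else 0)).Local v) →* ℂˣ, (𝔇.pi2 ξ').IsSquareIntegrable 𝔇.μGZ ∧ ¬ (𝔇.piN ξ').IsSquareIntegrable 𝔇.μGZ) →  -- hKeys
          𝔇.DetNotL2 →  -- hDet
          𝔇.PacketCharHRegularity →  -- hM1H
          (∀ ψ' : ↥(Subgroup.center (Gqs L v)) →* ℂˣ, Continuous ψ' → 𝔇.IsL2 (𝔇.stG ψ')) →  -- hStL2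
          𝔇.cartanG = Sell →  -- eCartanG
          (∀ T' : Subgroup (Gqs L v), 𝔇.μT T' = μTf T') →  -- eMuT
          𝔇.cartanH = SH →  -- eCartanH
          (∀ T' : Subgroup ((UnitaryGroup.cmDatum L 2 (Matrix.of fun i j : Fin 2 => if i.val + j.val + 1 = 2 then (1 : L) else 0)).Local v × (UnitaryGroup.cmDatum L 1 (Matrix.of fun i j : Fin 1 => if i.val + j.val + 1 = 1 then (1 : L) else 0)).Local v), 𝔇.μTH T' = μTHf T') →  -- eMuTH
          (∀ a : ((UnitaryGroup.cmDatum L 2 (Matrix.of fun i j : Fin 2 => if i.val + j.val + 1 = 2 then (1 : L) else 0)).Local v × (UnitaryGroup.cmDatum L 1 (Matrix.of fun i j : Fin 1 => if i.val + j.val + 1 = 1 then (1 : L) else 0)).Local v), a ∈ 𝔇.regH ↔ IsLocalGRegular L v a) →  -- eRegH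
          (∀ a : ((UnitaryGroup.cmDatum L 2 (Matrix.of fun i j : Fin 2 => if i.val + j.val + 1 = 2 then (1 : L) else 0)).Local v × (UnitaryGroup.cmDatum L 1 (Matrix.of fun i j : Fin 1 => if i.val + j.val + 1 = 1 then (1 : L) else 0)).Local v), a ∈ 𝔇.ellH ↔ IsLocalGRegular L v a ∧ IsCompact ((Subgroup.centralizer ({a} : Set ((UnitaryGroup.cmDatum L 2 (Matrix.of fun i j : Fin 2 => if i.val + j.val + 1 = 2 then (1 : L) else 0)).Local v × (UnitaryGroup.cmDatum L 1 (Matrix.of fun i j : Fin 1 => if i.val + j.val + 1 = 1 then (1 : L) else 0)).Local v)) : Subgroup ((UnitaryGroup.cmDatum L 2 (Matrix.of fun i j : Fin 2 => if i.val + j.val + 1 = 2 then (1 : L) else 0)).Local v × (UnitaryGroup.cmDatum L 1 (Matrix.of fun i j : Fin 1 => if i.val + j.val + 1 = 1 then (1 : L) else 0)).Local v)) : Set ((UnitaryGroup.cmDatum L 2 (Matrix.of fun i j : Fin 2 => if i.val + j.val + 1 = 2 then (1 : L) else 0)).Local v × (UnitaryGroup.cmDatum L 1 (Matrix.of fun i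 j : Fin 1 => if i.val + j.val + 1 = 1 then (1 : L) else 0)).Local v))) →  -- eEllH
          𝔇.sqPacketsH = {({πSt} : Finset (IrrClass ((UnitaryGroup.cmDatum L 2 (Matrix.of fun i j : Fin 2 => if i.val + j.val + 1 = 2 then (1 : L) else 0)).Local v × (UnitaryGroup.cmDatum L 1 (Matrix.of fun i j : Fin 1 => if i.val + j.val + 1 = 1 then (1 : L) else 0)).Local v)))} →  -- eSq
          (∀ π : IrrClass (Gqs L v), (∃ (χ₁ : (UnitaryGroup.LocalRing L v)ˣ →* ℂˣ) (χ₂ : ↥(normOneUnits (conjLocal L (IsCMField.complexConj L) v)) →* ℂˣ), Continuous (fun x => ((χ₁ x : ℂˣ) : ℂ)) ∧ Continuous (fun x => ((χ₂ x : ℂˣ) : ℂ)) ∧ (UnitaryGroup.cmPrincipalSeries L 3 v (UnitaryGroup.cmTorusCharPair L v χ₁ χ₂)).IsIrreducible ∧ π.IsConstituentOf (UnitaryGroup.cmPrincipalSeries L 3 v (UnitaryGroup.cmTorusCharPair L v χ₁ χ₂))) → π ∈ 𝔇.irredPS) →  -- eIrr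
          (∀ (η₁ η₂ : ↥(normOneUnits (conjLocal L (IsCMField.complexConj L) v)) →* ℂˣ), Continuous (fun x => ((η₁ x : ℂˣ) : ℂ)) → Continuous (fun x => ((η₂ x : ℂˣ) : ℂ)) → ∀ ξ' : ((UnitaryGroup.cmDatum L 2 (Matrix.of fun i j : Fin 2 => if i.val + j.val + 1 = 2 then (1 : L) else 0)).Local v × (UnitaryGroup.cmDatum L 1 (Matrix.of fun i j : Fin 1 => if i.val + j.val + 1 = 1 then (1 : L) else 0)).Local v) →* ℂˣ, (∀ hh : ((UnitaryGroup.cmDatum L 2 (Matrix.of fun i j : Fin 2 => if i.val + j.val + 1 = 2 then (1 : L) else 0)).Local v × (UnitaryGroup.cmDatum L 1 (Matrix.of fun i j : Fin 1 => if i.val + j.val + 1 = 1 then (1 : L) else 0)).Local v), ξ' hh = η₁ (localDet (IsCMField.complexConj L) v (isUnit_antidiagOne_det L 2) hh.1) * η₂ (localDet (IsCMField.complexConj L) v (isUnit_antidiagOne_det L 2) hh.1 * localDet (IsCMField.complexConj L) v (isUnit_antidiagOne_det L 1) hh.2)) → KeysCaseTwoLabels L v (μ.semilocalComponent L v) η₁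 η₂ (𝔇.pi2 ξ') (𝔇.piN ξ')) →  -- eLab
          (∀ ρ : IrrClass ((UnitaryGroup.cmDatum L 2 (Matrix.of fun i j : Fin 2 => if i.val + j.val + 1 = 2 then (1 : L) else 0)).Local v × (UnitaryGroup.cmDatum L 1 (Matrix.of fun i j : Fin 1 => if i.val + j.val + 1 = 1 then (1 : L) else 0)).Local v), 𝔇.charH ρ = 𝔇.charH πSt) →  -- eCharH
          (∃ (ιZ : ↥(normOneUnits (conjLocal L (IsCMField.complexConj L) v)) →* ↥(Subgroup.center (Gqs L v))) (detZ : (Gqs L v) →* ↥(Subgroup.center (Gqs L v))), Continuous ιZ ∧ Continuous detZ ∧ (∀ z : ↥(normOneUnits (conjLocal L (IsCMField.complexConj L) v)), ((ιZ z).val.val.val : Matrix (Fin 3) (Fin 3) (UnitaryGroup.LocalRing L v)) = (((z : (UnitaryGroup.LocalRing L v)ˣ) : UnitaryGroup.LocalRing L v)) • (1 : Matrix (Fin 3) (Fin 3) (UnitaryGroup.LocalRing L v))) ∧ (∀ g : (Gqs L v), ((detZ g).val.val.val : Matrix (Fin 3) (Fin 3) (UnitaryGroup.LocalRing L v)) =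 (g.val.val : Matrix (Fin 3) (Fin 3) (UnitaryGroup.LocalRing L v)).det • (1 : Matrix (Fin 3) (Fin 3) (UnitaryGroup.LocalRing L v))) ∧ ∀ ψ : ↥(Subgroup.center (Gqs L v)) →* ℂˣ, Continuous ψ → (∃ hopen : IsOpen (((ψ.comp detZ).ker : Subgroup (Gqs L v)) : Set (Gqs L v)), 𝔇.detG ψ = IrrClass.mk (SmoothIrrep.ofChar (ψ.comp detZ) hopen)) ∧ 𝔇.stG ψ ≠ 𝔇.detG ψ ∧ (∀ c : IrrClass (Gqs L v), c.IsConstituentOf (cmPrincipalSeries L 3 v (cmTorusCharPair L v (halfModulusChar (UnitaryGroup.LocalRing L v) * halfModulusChar (UnitaryGroup.LocalRing L v))⁻¹ (ψ.comp ιZ))) ↔ (c = 𝔇.stG ψ ∨ c = 𝔇.detG ψ)) ∧ (𝔇.stG ψ).IsSquareIntegrable μZ ∧ ¬ (𝔇.detG ψ).IsSquareIntegrable μZ) →  -- eSt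
      ∀ π π' : IrrClass (Gqs L v), 𝔇.IsEllipticRep π → 𝔇.IsEllipticRep π' →
        𝔇.innerG (𝔇.char π) (𝔇.char π') ≠ 0 → π ≠ π' → 𝔇.IsEllipticPair π π' := by
  intro L _ _ _ μ ξ v hns hμu hμω _ _ _ _ νHv νQv _ _ _ _ mHv mQv hcanH hcanQ hT_v π₁ πSt hlab hπ₁ _ _ μZ _ Sell μTf SH μTHf hcartO hcovGO hncGO hHaarGO hcoreGO
    hHaarMO hcoreMO hKHO hcovHO hncHO hHaarHO hprobHO 𝔇 par hC01 hC02 hC03 hC04 hC05 hC06 hC07 hE hchar hAll hHaar hcart hHaarG hfinG hker eDG eDH hKH hFH hHBH hNL hPSpar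
    hLdsF hW hStH hRegH hUp hHBHP hlabels hSt hStJH hKeysJH hM1lc hcovA hncA hcptA hinvT hcoreT hIrr hKeys hDet hM1H hStL2 eCartanG eMuT eCartanH eMuTH eRegH eEllH eSq
    eIrr eLab eCharH eSt π π' hπ hπ' hne0 hne
  -- (0) the wild kernel and Keys' list, read back at this frame BY NAME (every binder ∕ pin passed verbatim)
  have hWildv := hWild L μ ξ v hns hμu hμω νHv νQv mHv mQv hcanH hcanQ hT_v π₁ πSt hlab hπ₁ μZ Sell μTf SH μTHf hcartO hcovGO hncGO hHaarGO hcoreGO hHaarMO hcoreMO hKHO hcovHO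
    hncHO hHaarHO hprobHO 𝔇 par hC01 hC02 hC03 hC04 hC05 hC06 hC07 hE hchar hAll hHaar hcart hHaarG hfinG hker eDG eDH hKH hFH hHBH hNL hPSpar hLdsF hW hStH hRegH hUp hHBHP
    hlabels hSt hStJH hKeysJH hM1lc hcovA hncA hcptA hinvT hcoreT hIrr hKeys hDet hM1H hStL2 eCartanG eMuT eCartanH eMuTH eRegH eEllH eSq eIrr eLab eCharH eSt
  have hKeysRedv := hKeysRed L v hns
  letI : ∀ γ : Gqs L v, MeasurableSpace (Gqs L v ⧸ Subgroup.centralizer ({γ} : Set (Gqs L v))) := fun _ => borel _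
  haveI : ∀ γ : Gqs L v, BorelSpace (Gqs L v ⧸ Subgroup.centralizer ({γ} : Set (Gqs L v))) := fun _ => ⟨rfl⟩
  -- (1) ★ DG-FIELD: measurability and the dichotomy of `D_G` from the closed formula `eDG`
  have hDGm : Measurable 𝔇.DG := F0P3cStCharTSDGField.measurable_DG L v 𝔇 eDG
  have hDG := F0P3cStCharTSDGField.DG_eq_zero_or_le L v 𝔇 eDG
  -- (2) ★ WIF-AT-THE-DATUM: the Weyl integration formula from the Cartan pins (compact-Cartan tube-Jacobian socket ★ JAC-ELL C8; M-socket ★ JAC-LOC inside the head)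
  have hShapeA : ∀ T' ∈ 𝔇.cartanAll, ∃ γ₀ : Gqs L v, IsRegularElt (γ₀.val : GL (Fin 3) (UnitaryGroup.LocalRing L v)) ∧ T' = Subgroup.centralizer ({γ₀} : Set (Gqs L v)) :=
    fun T' hT' => by
      rcases (hAll T').1 hT' with h | h
      · subst h; obtain ⟨m₀, -, hreg, hZ⟩ := F0P3cStCharTSCartanReps.exists_isRegularElt_centralizer_eq_cmTorus L v hns; exact ⟨m₀, hreg, hZ.symm⟩
      · exact (hcart T' h).2
  have hHaarT : ∀ T' ∈ 𝔇.cartanAll, (𝔇.μT T').IsHaarMeasure := fun T' hT' => by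
    rcases (hAll T').1 hT' with h | h
    · subst h; exact hHaar
    · exact hHaarG T' h
  have hWIF : 𝔇.WeylIntegrationFormula :=
    F0P3cStCharTSWeylDatumPinsWIF.weylIntegrationFormula_of_datumPins L v hns νQv mQv 𝔇 hC01 hC04 hcanQ hC05 hShapeA hcovA hncA hcptA hHaarT hinvT hcoreT eDG
      (F0P3cStCharTSJacCartanTerminus.tubeJacobianSocket_compactCartan L v hns νQv)
  -- (3) ★ CARTAN-FIELDS ∕ CARTAN-NULL: (C1)(C2)(C3); ★ L2D-ELL over ★ L2D-OF-HCB: `|D_G| χ_π ∈ L²(T)` on every Cartan subgroup (the ONE use of `hHCB`)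
  have hC2cert : 𝔇.EllCartanAE :=
    F0P3cStCharTSCartanFields.ellCartanAE_of_compact_centralizers L v 𝔇 hE hcart
      (F0P3cStCharTSCartanNull.cartanNull_of_rootKernels L v 𝔇 hHaarG (fun T hT => (hcart T hT).1) hker)
  have hC1cert : 𝔇.EllCartanSubset := fun T hT => (hAll T).2 (Or.inr hT)
  have hC3cert : 𝔇.NonEllCartanAE :=
    F0P3cStCharTSCartanFields.nonEllCartanAE_of_split L v 𝔇 hC05 hE (fun T hT hTn => ((hAll T).1 hT).resolve_right hTn) hHaar
  have hL2allcert : 𝔇.L2CharOnTorusAll :=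
    F0P3cStCharTSL2dEll.l2CharOnTorusAll_of_elliptic 𝔇 hC2cert
      (K2E3L2dOfHcbLeThree.l2dEll_of_hcBounded L v hHCB hns νQv 𝔇 hC01 hC05 hchar hDGm (fun T hT => (hcart T hT).1) hfinG hDG)
  -- (4) ★ KEYS3-ANALYTIC → ★ LDS-RED-TWO → ★ LDS-TWO-OF-TWO (in house): the l.d.s. series have two distinct constituents; then ★ RED-JH: Rogawski's §12.2 list from `hKeysRed`
  have hLdsTwo := F0P3cStCharTSLdsTwoOfTwo.ldsTwo_of_ldsReducibleTwo L v hns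
    (F0P3cStCharTSLdsRedTwoOfReducible.ldsRedTwo_of_keysRedThree L v hns (F0P3cStCharTSKeys3AnalyticHalf.hKeysRed3_holds L v hns))
  have hRedJH := F0P3cStCharTSRedJH.redJH_of_keysRed L v hns 𝔇 (μ.semilocalComponent L v)
    (isQuadraticCharExtension_semilocalComponent_of_baseChange_eq μ hμω v) (Units.continuous_val.comp (UnitaryGroup.continuous_semilocalComponent L μ))
    hKeysRedv hStJH hKeysJH hLdsF hLdsTwo
  -- (5) the case split of ★ JUNCTION v17 :345–:356
  by_cases hsc' : π'.IsSupercuspidal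
  · exact absurd (F0P3cStCharTSScPseudoCoeff.innerG_char_eq_zero_of_ne_of_isSupercuspidal L v hns νQv mQv hcanQ 𝔇 hC01 hC04 hC05 hE hchar hWIF hC1cert hC2cert hC3cert
      hL2allcert π π' hsc' hne) hne0
  · by_cases hsc : π.IsSupercuspidal
    · have h0 := F0P3cStCharTSScPseudoCoeff.innerG_char_eq_zero_of_ne_of_isSupercuspidal L v hns νQv mQv hcanQ 𝔇 hC01 hC04 hC05 hE hchar hWIF hC1cert hC2cert hC3cert
        hL2allcert π' π hsc (Ne.symm hne)
      have h0' : 𝔇.innerG (𝔇.char π) (𝔇.char π') = 0 := by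
        rw [F0P3cStCharTSScFin.innerG_conj_symm 𝔇 (𝔇.char π') (𝔇.char π), h0, map_zero]
      exact absurd h0' hne0
    · by_cases hunr : (Algebra.IsUnramifiedIn (𝓞 L) v.asIdeal ∨ Valued.v (2 : v.adicCompletion ↥(maximalRealSubfield L)) = 1)
      · -- NOT WILD: ★ (X3′) «(b)-REST NOT-WILD» with ★ PS-VANISH, ★ LDS-FIELDS (2) and ★ RED-JH as its ELL-CLASS letters
        exact F0P3cStCharTSP1261bRestNotWild.isEllipticPair_of_innerG_ne_zero_of_not_wild L v hns hunr νQv mQv hcanQ 𝔇 hC01 hC04 hC05 hE hchar hWIF hC1cert hC2cert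
          hC3cert hL2allcert
          (F0P3cStCharTSPsVanish.char_eq_zero_on_ellG_of_isConstituentOf_irreducible L v hns νQv mQv hcanQ 𝔇 hC01 hC05 (fun γ hγ => (hE γ).1 hγ) hchar)
          (F0P3cStCharTSLdsFields.lds_sockets_of_ldsFields hns μZ 𝔇 hC03 hLdsF).2 hRedJH π π' hπ hπ' hsc hsc' hne0 hne
      · -- WILD: the named input (its EP-pair guard is vacuous at a wild place)
        exact hWildv π π' hπ hπ' hsc hsc' hunr (fun hep => hunr hep.1) hne0 hne

end Summit.HodgeConjecture.HodgeConjecture.Cruxes.H413.K2E3EllipticInnerNonzeroIsPairLeThree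

end
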